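import Literature.MathematicalPhysics.QuantumFieldTheory.Dimock2011to13.ClusterExpansionWithHoles

/-!
# Dimock, *The renormalization group according to Balaban* II App. F THEOREM F.1 `\label{cluster3}` and I App. B
# THEOREM `\label{cluster}` IN THE PRINTED INDEXING — the regrouped gas indexed by the UNIONS `Y = ∪X_i` with
# Ω-connectivity, `K(Y)`, `H^#(Y)`, (simplon)∕(sunshine) with the decay length `d_M(Y, mod Ω^c)`, the integration step,
# and part I's THEOREM `cluster` as the hole-free case

**Citation header (reproduction of PUBLISHED work; template of the Bałaban lattice Yang–Mills cell).**
J. Dimock, *The renormalization group according to Balaban II. Large fields*, J. Math. Phys. **54** (2013) 092301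
(= arXiv:1212.5562v2) [Dimock2013BalabanII], Appendix F THEOREM F.1 `\label{cluster3}` (L6973–6997, eqs. (gog2),
(sunshine)), the remark L7000 (the *"local influence property"*), its proof (L7003–7083): (keykey1)∕(keykey2) L7007–7014,
the Mayer expansion with Ω-connectivity L7016–7039 (*"K(Y) = Σ_{{X_i}: ∪_i X_i = Y} Π_i(e^{H(X_i)} − 1)"*, L7031–7034),
(otter) L7041–7045, (simplon) L7046–7049, the integration step L7051–7061, the exponentiation L7063–7077; and J. Dimock,
*The renormalization group according to Balaban I. Small fields*, Rev. Math. Phys. **25** (2013) 1330010 (=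
arXiv:1108.1335v2) [Dimock2013], Appendix B THEOREM `\label{cluster}` (L3170–3194, eqs. (sunshine), (sunshine0)).  TeX
line numbers refer to the arXiv sources held by the cell (`inputs/files/dimock/src/1212.5562/1212.5562.tex`, sha16
75c5792fc48eacbc; `…/1108.1335/1108.1335.tex`); every quotation below was read there this session.  Dimock's papers are
published and refereed and are the cell's TEMPLATE, not manuscripts under audit; no quantity of the Bałaban series is
touched.

**What the paper prints (verbatim, TeX → Unicode; re-read against the held TeX for v1.1.1).**  THEOREM F.1 (L6984–6996):
*"Let c_0 = 𝒪(1) be sufficiently small, let H_0 ≤ c_0, let κ ≥ 3κ_0 + 3, and suppose  |H(X,Φ′,Φ)| ≤ H_0 e^{−κ d_M(X, mod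
Ω^c)}  X ∈ 𝒟_k(mod Ω^c)  on the support of μ_Λ. Then  Ξ = exp( Σ_{Y ∈ 𝒟_k(mod Ω^c), Y∩Λ ≠ ∅} H^#(Y,Φ′) )  (gog2)  where
H^#(Y,Φ′) depends on Φ′ only in Y and satisfies  |H^#(Y,Φ′)| ≤ 𝒪(1) H_0 e^{−(κ − 3κ_0 − 3) d_M(Y, mod Ω^c)}  (sunshine)"*.
L7018–7021: *"Now we say that X_1, X_2 ∈ 𝒟_k(mod Ω^c) are Ω-connected if X_1 ∩ Ω and X_2 ∩ Ω have non-empty intersection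
(i.e if X_1 ∩ X_2 ∩ Ω ≠ ∅). Otherwise X_1 ∩ Ω and X_2 ∩ Ω have empty intersection and they are called Ω-disjoint. Note that
Ω-connected implies connected, but Ω-disjoint does not imply disjoint."*  Proof (L7025–7035): *"First we make a Mayer
expansion and write  exp( Σ_X H(X) ) = Σ_{{Y_j}} Π_j K(Y_j)  where the Y_j are Ω-disjoint, and where … for Y ⊂ 𝒟_k(mod Ω^c)
and Y ∩ Λ ≠ ∅.  K(Y) = Σ_{{X_i}: ∪_i X_i = Y} Π_i (e^{H(X_i)} − 1)  The latter sum is restricted by the condition that the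
X_i are Ω-connected, i.e. cannot be divided into Ω-disjoint sets. K(Y) = K(Y,Φ′,Φ) only depends on Φ′ in Y and Φ in Y ∩
Λ."*; (simplon) L7046–7049: *"|K(Y)| ≤ 𝒪(1) H_0 e^{−(κ − κ_0 − 2) d_M(Y, mod Ω^c)}"* (the kernel keeps an explicit factor
`κ₀` inside its `𝒪(1)`, reading (iii)); L7063–7073: *"Next we exponentiate the sum and get  Σ_{{Y_j}} Π_j K^#(Y_j) = exp(
Σ_Y H^#(Y) )  where for Y ⊂ 𝒟_k(mod Ω^c) and Y ∩ Λ ≠ ∅.  H^#(Y) = Σ_{n=1}^∞ (1/n!) Σ_{(Y_1,…,Y_n): ∪_i Y_i = Y}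
ρ^T(Y_1,…,Y_n) Π_i K^#(Y_i)  (hstar)  and ρ^T(Y_1,…,Y_n) is now defined so it vanishes if the Y_j are not
Ω-connected."*  Part I THEOREM `cluster` (arXiv:1108.1335v2 L3178–3194): *"There is a constant c_0 depending only on the
dimension such that if H(X,Φ) satisfies  |H(X,Φ)| ≤ H_0 e^{−κ d_M(X)}  on the support of μ with κ > 3κ_0 + 3 and H_0 ≤ c_0
then  Ξ = exp( Σ_Y H^#(Y) )  where H^#(Y) only depends on H(X) for X ⊂ Y and  |H^#(Y)| ≤ 𝒪(1) H_0 e^{−(κ − 3κ_0−3) d_M(Y)}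
(sunshine0)  The constant 𝒪(1) depends only on the dimension."* (the display `Ξ = exp(Σ_Y H^#(Y))` of App. B is
UNLABELLED; `\label{sunshine}` of part I is in the main text, L2512).

**Why this module (what it adds to the sibling `ClusterExpansionWithHoles`).**  The sibling proved THEOREM F.1 on the
torus with the regrouped gas indexed by the Ω-PARTS `V = Y ∩ Ω` (its reading (vi)) and, consequently, with the decay of
(simplon)∕(sunshine) in the Steiner length `coverLen univ (Y ∩ Ω)` of the Ω-part instead of the printed `d_M(Y, mod Ω^c)`
(a weaker bound: `coverLen univ (Y ∩ Ω) ≤ d_M(Y, mod Ω^c)`); and TEMPLATE.md §4.2 row «D1 §4.6» recorded *"what is NOT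
assembled is the single statement THEOREM `cluster`∕(sunshine0) with Dimock's constants"*.  This module removes the
sibling's reading (vi) and closes that residue: the App. B∕F regrouping is redone INDEXED BY THE FULL UNIONS `Y = ∪_i X_i`
with Ω-CONNECTIVITY (the printed objects: `K(Y)`, families `{Y_j}` with disjoint `Y_j ∩ Ω`, hard core `Y ∩ Y′ ∩ Ω ≠ ∅`,
`H^#(Y)`), (simplon) and (sunshine) are proved WITH THE PRINTED DECAY LENGTH `d_M(Y, mod Ω^c)` — by the printed route:
(otter) `HolePolymerKeyBounds.lemma_otter` applies to the Ω-connected covers of `Y` directly, (keykey1)∕(keykey2) to the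
unions `Y` (which are again localization domains `mod Ω^c` with non-empty classes, Part 2) — and part I's THEOREM
`cluster` with (sunshine0) in `d_M(Y)` falls out as the hole-free case `Θ = ∅` (Part 6).

**What is reproduced here (kernel-checked, zero `sorry`).**
* Part 1 — THE REGROUPING INDEXED BY UNIONS (generic polymer type `P` with cube sets `idx : P → Finset C`, holes `Θ`):
  `suppΩ`, `UY`, `coversY` (Ω-connected covers with union `Y`), **`KY`** (the printed `K(Y)`), `FibY`, **`famDY`** (families
  with pairwise disjoint non-empty Ω-parts), `UY_sdiff` (`(∪X_i) ∩ Ω = ∪(X_i ∩ Ω)`, the bridge to `MayerExpansion.U`),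
  `disjoint_UY_iff`, `UY_injOn`, **`sum_FibY_eq_prod_KY`** (the fibre identity), `sum_admissible_eq_sum_famDY`,
  **`mayer_expansionY`** ∕ `exp_sum_eq_mayerY` ∕ `cexp_sum_eq_mayerY` (`Π_X(1 + a_X) = Σ_{{Y_j}} Π_j K(Y_j)`); the hard core
  **`IncΩ`** (`Y ∩ Y′ ∩ Ω ≠ ∅`), `unionsY`, `mem_famDY_iff_isCompatible`, **`sum_famDY_prod_eq_polymerPartitionFunction`**
  (the regrouped sum is `Ξ_{unionsY}(w)` for ANY activity), **`HsharpL`** (`H^#(Y)` over a finite volume of unions, KP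
  form), `polymerPartitionFunction_eq_cexp_sum_HsharpL` (exponentiation by the tree's Kotecký–Preiss theorem),
  **`HsharpL_congr_local`** (the local influence property L7000), `polymerPartitionFunction_eq_of_zero_off` (zero-activity
  polymers drop out of a hard-core partition function).
* Part 2 — Ω-CONNECTED UNIONS ON THE TORUS: **`tFaceConnected_biUnion`** (an Ω-connected family of face-connected polymers
  has a face-connected union), `dMod_biUnion`, **`geom_of_mem_coversY`** (the union of an Ω-connected cover from `Pol` is a
  non-empty face-connected localization domain `mod Θ` meeting `Ω` with non-empty class), and **(simplon) WITH THE PRINTED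
  DECAY `norm_KY_le`**: `‖K(Y)‖ ≤ 2e·K₁(d)·κ₀·H₀·e^{−(κ−κ₀−2)·d_M(Y, mod Θ)}` (`ClusterActivityBound.norm_clusterSum_le_final`
  with (clams) = `lemma_otter_of_isConnColl`, (sudsy) = `lemma_keykey1`, (ninety) = `card_sdiff_le_torusTreeLenMod`).
* Part 3 — THE KOTECKÝ–PREISS CONDITION OF THE GAS OF Ω-CONNECTED UNIONS `cunions` (size `kpSizeΩ θ Θ Y = θ|Y ∩ Ω|`, decay
  `kpDecayΩ δ Θ Y = δ(d_M(Y, mod Θ) + 1)`, the sibling's constants `delta`, `theta`, `Csharp`): `KY_eq_zero_of_not_mem`,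
  `omegaConnected_of_isPolymerCluster`, **`kpDecayΩ_biUnion_le_sum`** ((otter) for the clusters of the gas of unions),
  **`kp_sum_leY`** (the KP sum `≤ θ|Y ∩ Ω|`, cover sum by (keykey1) `lemma_keykey1`), `isKPVolumeY`, `touchSum_leY`,
  **`norm_HsharpL_leY`**, **`sunshineY_of_norm_le`** (`‖H^#(Y)‖ ≤ C♯(d,κ₀)·H₀·e^{−(κ−3κ₀−3)·d_M(Y, mod Θ)}` for any activity
  with the (simplon) bound).
* Part 4 — THEOREM F.1 AT A FIXED FIELD, PRINTED INDEXING: `cexp_sum_eq_polymerPartitionFunction_cunions`, **`gog2Y`**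
  (`exp(Σ_X H(X)) = exp(Σ_Y H^#(Y))`), **`sunshineY`**, `sunshineY_of_H`.
* Part 5 — WITH THE INTEGRATION STEP (fields `Φ : TPt d N → E`, ultralocal `μ_Λ = ⊗_c ν_c`): `KYfield`, `dependsOn_KYfield`
  (`K(Y, ·)` depends on the field only in `Y ∩ Ω`), `abs_KYfield_le`, `KYsharp` (`K^# = ∫K dμ_Λ`), `measurable_KYfield`,
  `abs_KYsharp_le` (*"K^# again satisfies the bound (simplon)"*), **`integral_exp_sum_eq_sum_famDY`** (steps 1–2 by
  independence over the disjoint Ω-parts, `UltralocalFactorization.integral_prod_eq_prod_integral`), **`gog2Y_integrated`**,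
  **`sunshineY_integrated`**.
* Part 6 — PART I's THEOREM `cluster` AS THE HOLE-FREE CASE: `pol_of_noHoles`, `torusTreeLenMod_empty` (`d_M(Y, mod ∅) =
  d_M(Y)`), **`sunshine_partI`** ((sunshine0) with decay `d_M(Y)`), **`cluster_partI`** ((sunshine) at a fixed field),
  **`cluster_partI_integrated`** (with the integration over all fields, `H(X, ·)` depending on the field in `X`),
  **`sunshine_partI_integrated`**.
* Part 7 (v1.1) — RESTRICTION TO THE POLYMERS INSIDE `Λ` (§3.14 Lemma *"leading terms"*, L5597–5604: *"E_k^#(Y, φ) … is the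
  same as the global definition in part I, even though here we are only summing over polymers in Λ_{k+1} … by the local
  influence property"*): `coversY_restrict`, `KY_restrict`, `HsharpL_congr_volume`, `mem_cunions_restrict_iff`,
  **`HsharpL_restrict`** ∕ `HsharpL_restrict_filter` (for `Y ⊆ Λ`, `H^#(Y)` from the polymers inside `Λ` = `H^#(Y)` from all of
  `Pol`), `KYsharp_restrict`,
  **`HsharpL_KYsharp_restrict`** (the same for the integrated activities).

**Readings ∕ divergences (declared).**  (i) Carrier: the torus `TPt d N` of unit cubes with `d_M(·, mod Θ) =
ThreeSorted.torusTreeLenMod` (graphs in the universal cover), as in the whole lineage; `M`-cubes vs unit cubes is a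
rescaling of `κ` not tracked.  (ii) `H^#` is the Kotecký–Preiss form (sum of truncated functionals `Φ^T(𝒞)` over
sub-families `𝒞` of the finite volume `cunions` of Ω-connected unions with `∪𝒞 = Y`) — the print's `(1/n!)Σ ρ^T Π K` regrouped;
the unions WITHOUT an Ω-connected cover carry `K = 0` and are dropped from the volume (`polymerPartitionFunction_eq_of_zero_off`),
which changes neither `Ξ` nor the printed `H^#`.  (iii) Constants explicit: `𝒪(1)_{simplon} = 2e·K₁(d)`, `C♯ =
8e·2^d·K₁(d)²·κ₀·e^{4·2^d}`, regime `max(κ₁(d), 4·2^d) ≤ κ₀`, `3κ₀ + 3 ≤ κ`, `2e·K₁(d)²·κ₀·e^{κ}·H₀ ≤ 1` (the print's *"c_0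
sufficiently small depending on κ"*), `c_0 = H₀`.  (iv) The sum in (gog2) runs here over all unions `Y` of sub-families of
`cunions` (finite volume); the print's restriction *"Y ∩ Λ ≠ ∅"* is the support statement `H(X) = 0` unless `X ∩ Λ ≠ ∅`,
not separately typed.  (v) Part 6 is part I's theorem on the TORUS carrier (part I prints it on `𝕋^{−k}_{M+N−k}` as well);
its `𝒪(1)` carries the factor `κ₀` (dimension-only after fixing `κ₀ = max(κ₁(d), 4·2^d)`).

**What is NOT claimed.**  Analyticity of `H^#` in parameters; infinite-volume limits; the identification of the KP form
of `H^#` with the `(1/n!)Σρ^T` series term by term (the tree's `LatticeModels` proves their equality as the Möbius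
transform of `log Ξ`, which is what is used); anything of B1–B16 (the rows' Bałaban side — B13 §2 Lemma 3, B16 §1 —
untouched).  NOT summit progress; NOT a statement about any Bałaban paper; NOT continuum; NOT Clay.  NEW leaf; imports
`…Dimock2011to13.ClusterExpansionWithHoles` only (this lineage); no Summits import; no cycle; modifies nothing; no named
fact (net debt 0).  Unit `b2b-balaban-template` gen 37 round 4 (journal CLAIM D2-THMF1-PRINTED-INDEXING-KERNEL); cell
records TEMPLATE.md §4.2 rows «D2 §3.14», «D1 §4.6», §15.2; GAPS C-tmpl37-4.

**Version.**  v1.1.1 (gen 38, 2026-08-20; DOCSTRING-ONLY fold of XREAD VERDICT journal l.15275, cert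
`t4/b2b-balaban-t4-ne1p-formalise-leaf-09/g9/xread/XREAD-ClusterExpansionByUnions-v1.1-p220732-p220917.md` §MQ-1…MQ-8 +
DOCFIX-1: the pseudo-verbatim strings of the header and of `UY`∕`coversY`∕`KY`∕`famDY`∕`disjoint_UY_iff`∕
`polymerPartitionFunction_eq_cexp_sum_HsharpL`∕`norm_KY_le`∕`sunshineY_of_norm_le`∕`integral_exp_sum_eq_sum_famDY`∕`sunshine_partI`∕
`cluster_partI_integrated` replaced by the TeX's words; Part 6's two «eq. (sunshine)» locators re-pointed at App. B's
unlabelled display; NO declaration, statement or proof changed).  v1 (gen 37 round 4, p220732): Parts 1–6.  v1.1 (gen 37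
round 5, same seat, 2026-08-20): + Part 7 (restriction to the
polymers inside `Λ`: `coversY_restrict`, `KY_restrict`, `mem_unionsY_restrict_iff`, `HsharpL_congr_volume`, `mem_cunions_restrict_iff`,
**`HsharpL_restrict`**, `HsharpL_restrict_filter`, `KYsharp_restrict`, **`HsharpL_KYsharp_restrict`** — the «leading terms» identification of §3.14 L5597–5604);
every v1 declaration unchanged; GAPS C-tmpl37-5.
-/

noncomputable section

open Real Finset
open Literature.MathematicalPhysics.QuantumFieldTheory.Balaban1983to89
open Literature.MathematicalPhysics.QuantumFieldTheory.Balaban1983to89.TreeLengthTorus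

namespace Literature.MathematicalPhysics.QuantumFieldTheory.Dimock2011to13.ClusterExpansionByUnions

open Literature.MathematicalPhysics.QuantumFieldTheory.Dimock2011to13.ThreeSorted
open Literature.MathematicalPhysics.QuantumFieldTheory.Dimock2011to13.HoleSummability
open Literature.MathematicalPhysics.QuantumFieldTheory.Dimock2011to13.HolePolymerKeyBounds
open Literature.MathematicalPhysics.QuantumFieldTheory.Dimock2011to13.MayerExpansion
open Literature.MathematicalPhysics.QuantumFieldTheory.Dimock2011to13.ClusterExpansionWithHoles
open Literature.Probability.LatticeModels
  (IsCompatible IsKPVolume kpTerm KPTouches touchSum touchSum_le_of_kp truncatedWeight truncatedWeight_congr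
    truncatedWeight_eq_zero_of_kp IsPolymerCluster polymerPartitionFunction polymerLogZ_eq_sum_truncatedWeight
    exp_polymerLogZ_of_kp)

/-! ## Part 1. The regrouping indexed by the unions `Y = ∪_i X_i`, with Ω-connectivity (App. F L7016–7034) -/

section Regroup

variable {P C : Type*} [DecidableEq P] [DecidableEq C]

/-- The Ω-support of a polymer: its cubes outside the holes, `X ∩ Ω` (L7019 *"X_i ∩ X_j ∩ Ω ≠ ∅"* is overlap of
Ω-supports). [cite: Dimock2013BalabanII, App. F Theorem cluster3, proof (arXiv:1212.5562v2 TeX L7016–7021)] -/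
def suppΩ (idx : P → Finset C) (Θ : Finset C) : P → Finset C := fun X => idx X \ Θ

/-- The union `Y = ∪_i X_i` of a sub-collection as a set of cubes, holes included (the `Y` of *"K(Y) = Σ_{{X_i}: ∪_i X_i
= Y} Π_i (e^{H(X_i)} − 1)"*, L7031–7033). [cite: Dimock2013BalabanII, App. F Theorem cluster3, proof (arXiv:1212.5562v2 TeX L7025–7034)] -/
def UY (idx : P → Finset C) (T : Finset P) : Finset C := T.biUnion idx

/-- THE Ω-CONNECTED COVERS OF `Y`: sub-collections `{X_i} ⊆ Pol` that are Ω-connected in the printed sense (*"The latter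
sum is restricted by the condition that the X_i are Ω-connected, i.e. cannot be divided into Ω-disjoint sets"*, L7034 —
chain-connectivity for the Ω-overlap `X ∩ X′ ∩ Ω ≠ ∅` of L7018–7019), with `∪_i X_i = Y` — the index set of the printed `K(Y)`.
[cite: Dimock2013BalabanII, App. F Theorem cluster3, proof (arXiv:1212.5562v2 TeX L7016–7034)] -/
def coversY (idx : P → Finset C) (Θ : Finset C) (Pol : Finset P) (Y : Finset C) : Finset (Finset P) := by
  classical exact Pol.powerset.filter fun T => IsConnColl (MayerExpansion.Overlap (suppΩ idx Θ)) T ∧ UY idx T = Y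

/-- **`K(Y) = Σ_{{X_i}: ∪_i X_i = Y} Π_i (e^{H(X_i)} − 1)`** — [Dimock2013BalabanII] App. F, verbatim (L7031–7034): *"K(Y) =
Σ_{{X_i}: ∪_i X_i = Y} Π_i (e^{H(X_i)} − 1)  The latter sum is restricted by the condition that the X_i are Ω-connected"*,
for a general cluster weight `g`. [cite: Dimock2013BalabanII, App. F Theorem cluster3, proof (arXiv:1212.5562v2 TeX L7025–7034)] -/
def KY {R : Type*} [AddCommMonoid R] (idx : P → Finset C) (Θ : Finset C) (Pol : Finset P) (g : Finset P → R)
    (Y : Finset C) : R :=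
  ∑ T ∈ coversY idx Θ Pol Y, g T

/-- the admissible families (pairwise Ω-separated Ω-connected clusters) whose members have unions exactly `𝒴`.
[cite: Dimock2013BalabanII, App. F Theorem cluster3, proof (arXiv:1212.5562v2 TeX L7016–7034)] -/
def FibY (idx : P → Finset C) (Θ : Finset C) (Pol : Finset P) (𝒴 : Finset (Finset C)) : Finset (Finset (Finset P)) :=
  (admissible (MayerExpansion.Overlap (suppΩ idx Θ)) Pol).filter fun 𝒯 => 𝒯.image (UY idx) = 𝒴

/-- THE FAMILIES `{Y_j}` OF THE REGROUPED SUM (L7025–7029 *"Σ_{{Y_j}} Π_j K(Y_j)  where the Y_j are Ω-disjoint"*): finite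
families of unions of sub-collections of `Pol` whose Ω-PARTS `Y_j ∩ Ω` are non-empty and pairwise disjoint (*"Ω-disjoint"* =
*"X_1 ∩ Ω and X_2 ∩ Ω have empty intersection"*, L7020). [cite: Dimock2013BalabanII, App. F Theorem cluster3, proof (arXiv:1212.5562v2 TeX L7018–7029)] -/
def famDY (idx : P → Finset C) (Θ : Finset C) (Pol : Finset P) : Finset (Finset (Finset C)) :=
  ((Pol.powerset.image (UY idx)).powerset).filter fun 𝒴 =>
    (∀ Y ∈ 𝒴, ∀ Y' ∈ 𝒴, Y ≠ Y' → Disjoint (Y \ Θ) (Y' \ Θ)) ∧ ∀ Y ∈ 𝒴, (Y \ Θ).Nonempty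

variable {idx : P → Finset C} {Θ : Finset C} {Pol : Finset P}

omit [DecidableEq P] in
/-- membership in the Ω-connected covers of `Y`. [cite: Dimock2013BalabanII, App. F Theorem cluster3, proof (arXiv:1212.5562v2 TeX L7016–7034)] -/
theorem mem_coversY {Y : Finset C} {T : Finset P} :
    T ∈ coversY idx Θ Pol Y ↔ T ⊆ Pol ∧ IsConnColl (MayerExpansion.Overlap (suppΩ idx Θ)) T ∧ UY idx T = Y := by
  classical
  unfold coversY; rw [Finset.mem_filter, Finset.mem_powerset]

/-- membership in the fibre over `𝒴`. [cite: Dimock2013BalabanII, App. F Theorem cluster3, proof (arXiv:1212.5562v2 TeX L7016–7034)] -/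
theorem mem_FibY {𝒴 : Finset (Finset C)} {𝒯 : Finset (Finset P)} :
    𝒯 ∈ FibY idx Θ Pol 𝒴 ↔ 𝒯 ∈ admissible (MayerExpansion.Overlap (suppΩ idx Θ)) Pol ∧ 𝒯.image (UY idx) = 𝒴 := Finset.mem_filter

omit [DecidableEq P] in
/-- membership in the families of the regrouped sum. [cite: Dimock2013BalabanII, App. F Theorem cluster3, proof (arXiv:1212.5562v2 TeX L7025–7039)] -/
theorem mem_famDY {𝒴 : Finset (Finset C)} :
    𝒴 ∈ famDY idx Θ Pol ↔ (∀ Y ∈ 𝒴, Y ∈ Pol.powerset.image (UY idx)) ∧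
      (∀ Y ∈ 𝒴, ∀ Y' ∈ 𝒴, Y ≠ Y' → Disjoint (Y \ Θ) (Y' \ Θ)) ∧ ∀ Y ∈ 𝒴, (Y \ Θ).Nonempty := by
  unfold famDY; rw [Finset.mem_filter, Finset.mem_powerset]; rfl

omit [DecidableEq P] in
/-- **the Ω-part of the union is the union of the Ω-supports**: `(∪_i X_i) ∩ Ω = ∪_i (X_i ∩ Ω)` — the bridge to the
App. B kernel's `MayerExpansion.U`. [cite: Dimock2013BalabanII, App. F Theorem cluster3, proof (arXiv:1212.5562v2 TeX L7035–7039)] -/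
theorem UY_sdiff (T : Finset P) : UY idx T \ Θ = U (suppΩ idx Θ) T := by
  ext c
  simp only [UY, U, suppΩ, Finset.mem_sdiff, Finset.mem_biUnion]
  constructor
  · rintro ⟨⟨X, hX, hc⟩, hcΘ⟩
    exact ⟨X, hX, hc, hcΘ⟩
  · rintro ⟨X, hX, hc, hcΘ⟩
    exact ⟨⟨X, hX, hc⟩, hcΘ⟩

omit [DecidableEq P] in
/-- **the Ω-parts of two unions are disjoint iff the sub-collections are Ω-separated** (*"the Y_j are Ω-disjoint"*, L7029;
*"Ω-disjoint"* L7020). [cite: Dimock2013BalabanII, App. F Theorem cluster3, proof (arXiv:1212.5562v2 TeX L7018–7029)] -/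
theorem disjoint_UY_iff {T T' : Finset P} :
    Disjoint (UY idx T \ Θ) (UY idx T' \ Θ) ↔ Separated (MayerExpansion.Overlap (suppΩ idx Θ)) T T' := by
  rw [UY_sdiff, UY_sdiff]
  exact disjoint_U_iff

omit [DecidableEq P] in
/-- a non-empty sub-collection of polymers meeting `Ω` has a union meeting `Ω`. [cite: Dimock2013BalabanII, App. F Theorem cluster3, proof (arXiv:1212.5562v2 TeX L7016–7034)] -/
theorem UY_sdiff_nonempty (hsupp : ∀ X ∈ Pol, (idx X \ Θ).Nonempty) {T : Finset P} (hT : T ⊆ Pol)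
    (hne : T.Nonempty) : (UY idx T \ Θ).Nonempty := by
  obtain ⟨X, hX⟩ := hne
  obtain ⟨c, hc⟩ := hsupp X (hT hX)
  rw [Finset.mem_sdiff] at hc
  exact ⟨c, Finset.mem_sdiff.2 ⟨Finset.mem_biUnion.2 ⟨X, hX, hc.1⟩, hc.2⟩⟩

omit [DecidableEq P] in
/-- Ω-separated non-empty sub-collections have different unions. [cite: Dimock2013BalabanII, App. F Theorem cluster3, proof (arXiv:1212.5562v2 TeX L7016–7039)] -/
theorem UY_ne_of_separated (hsupp : ∀ X ∈ Pol, (idx X \ Θ).Nonempty) {T T' : Finset P} (hT : T ⊆ Pol)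
    (hne : T.Nonempty) (hsep : Separated (MayerExpansion.Overlap (suppΩ idx Θ)) T T') : UY idx T ≠ UY idx T' := by
  intro h
  have hd : Disjoint (UY idx T \ Θ) (UY idx T' \ Θ) := disjoint_UY_iff.2 hsep
  rw [← h, disjoint_self, Finset.bot_eq_empty] at hd
  exact (UY_sdiff_nonempty hsupp hT hne).ne_empty hd

/-- in an admissible family distinct members have distinct unions. [cite: Dimock2013BalabanII, App. F Theorem cluster3, proof (arXiv:1212.5562v2 TeX L7016–7039)] -/
theorem UY_injOn (hsupp : ∀ X ∈ Pol, (idx X \ Θ).Nonempty) {𝒯 : Finset (Finset P)}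
    (h𝒯 : 𝒯 ∈ admissible (MayerExpansion.Overlap (suppΩ idx Θ)) Pol) : Set.InjOn (UY idx) 𝒯 := by
  intro T hT T' hT' h
  by_contra hne
  obtain ⟨hsub, hconn, hsep⟩ := mem_admissible.1 h𝒯
  exact UY_ne_of_separated hsupp (hsub T hT) (hconn T hT).1 (hsep T hT T' hT' hne) h

/-- the member of the family `𝒯` whose union is `Y` (junk unless there is exactly one). [folklore] -/
def theUY (idx : P → Finset C) (𝒯 : Finset (Finset P)) (Y : Finset C) : Finset P :=
  (𝒯.filter fun T => UY idx T = Y).biUnion id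

/-- in an admissible family the member with a given union is recovered by `theUY`. [cite: Dimock2013BalabanII, App. F Theorem cluster3, proof (arXiv:1212.5562v2 TeX L7016–7039)] -/
theorem theUY_eq (hsupp : ∀ X ∈ Pol, (idx X \ Θ).Nonempty) {𝒯 : Finset (Finset P)}
    (h𝒯 : 𝒯 ∈ admissible (MayerExpansion.Overlap (suppΩ idx Θ)) Pol) {T₀ : Finset P} (hT₀ : T₀ ∈ 𝒯) {Y : Finset C}
    (hY : UY idx T₀ = Y) : theUY idx 𝒯 Y = T₀ := by
  have hfilt : (𝒯.filter fun T => UY idx T = Y) = {T₀} := by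
    ext T
    simp only [Finset.mem_filter, Finset.mem_singleton]
    constructor
    · rintro ⟨hT, hTY⟩; exact UY_injOn hsupp h𝒯 hT hT₀ (hTY.trans hY.symm)
    · rintro rfl; exact ⟨hT₀, hY⟩
  simp [theUY, hfilt]

/-- the only admissible family with no unions is the empty family. [cite: Dimock2013BalabanII, App. F Theorem cluster3, proof (arXiv:1212.5562v2 TeX L7016–7039)] -/
theorem FibY_empty : FibY idx Θ Pol ∅ = {∅} := by
  ext 𝒯
  rw [mem_FibY, Finset.mem_singleton, Finset.image_eq_empty]
  constructor
  · rintro ⟨_, h⟩; exact h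
  · rintro rfl; exact ⟨mem_admissible.2 ⟨by simp, by simp, by simp⟩, rfl⟩

/-- **THE FIBRE IDENTITY IN THE PRINTED INDEXING**: for a family `𝒴` with pairwise disjoint Ω-parts, the admissible
families whose unions are exactly `𝒴` resum to `Π_{Y∈𝒴} K(Y)` — one Ω-connected cover per `Y`, independently (the
disjointness of the `Y ∩ Ω` makes the chosen clusters Ω-separated); induction on `𝒴` through `𝒯 ↦ (T₀, 𝒯 ∖ {T₀})`.
(The App. B kernel's `MayerExpansion.sum_Fib_eq_prod_K` is the same argument for the indexing by Ω-parts.)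
[cite: Dimock2013BalabanII, App. F Theorem cluster3, proof (arXiv:1212.5562v2 TeX L7016–7039)] -/
theorem sum_FibY_eq_prod_KY (hsupp : ∀ X ∈ Pol, (idx X \ Θ).Nonempty) {R : Type*} [CommSemiring R]
    (g : Finset P → R) :
    ∀ 𝒴 : Finset (Finset C), (∀ Y ∈ 𝒴, ∀ Y' ∈ 𝒴, Y ≠ Y' → Disjoint (Y \ Θ) (Y' \ Θ)) →
      ∑ 𝒯 ∈ FibY idx Θ Pol 𝒴, ∏ T ∈ 𝒯, g T = ∏ Y ∈ 𝒴, KY idx Θ Pol g Y := by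
  intro 𝒴
  induction 𝒴 using Finset.induction_on with
  | empty => intro _; simp [FibY_empty]
  | insert Y₀ 𝒴 hY₀ ih =>
    intro hdisj
    have hdisj' : ∀ Y ∈ 𝒴, ∀ Y' ∈ 𝒴, Y ≠ Y' → Disjoint (Y \ Θ) (Y' \ Θ) := fun Y hY Y' hY' hne =>
      hdisj Y (Finset.mem_insert_of_mem hY) Y' (Finset.mem_insert_of_mem hY') hne
    have hdisj0 : ∀ Y ∈ 𝒴, Disjoint (Y₀ \ Θ) (Y \ Θ) := fun Y hY =>
      hdisj Y₀ (Finset.mem_insert_self _ _) Y (Finset.mem_insert_of_mem hY) (fun h => hY₀ (h ▸ hY))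
    have hins : ∀ p ∈ coversY idx Θ Pol Y₀ ×ˢ FibY idx Θ Pol 𝒴,
        insert p.1 p.2 ∈ FibY idx Θ Pol (insert Y₀ 𝒴) := by
      rintro ⟨T₀, 𝒯'⟩ hp
      obtain ⟨hT₀, h𝒯'⟩ := Finset.mem_product.1 hp
      obtain ⟨hT₀sub, hT₀conn, hUT₀⟩ := mem_coversY.1 hT₀
      obtain ⟨hadm', himg'⟩ := mem_FibY.1 h𝒯'
      obtain ⟨hsub', hconn', hsep'⟩ := mem_admissible.1 hadm'
      have hsep0 : ∀ T' ∈ 𝒯', Separated (MayerExpansion.Overlap (suppΩ idx Θ)) T₀ T' := by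
        intro T' hT'
        have hUT' : UY idx T' ∈ 𝒴 := himg' ▸ Finset.mem_image_of_mem _ hT'
        have hd := hdisj0 _ hUT'
        rw [← hUT₀] at hd
        exact disjoint_UY_iff.1 hd
      refine mem_FibY.2 ⟨mem_admissible.2 ⟨?_, ?_, ?_⟩, ?_⟩
      · intro T hT
        rcases Finset.mem_insert.1 hT with rfl | h
        · exact hT₀sub
        · exact hsub' T h
      · intro T hT
        rcases Finset.mem_insert.1 hT with rfl | h
        · exact hT₀conn
        · exact hconn' T h
      · intro T hT T' hT' hne
        rcases Finset.mem_insert.1 hT with rfl | h <;> rcases Finset.mem_insert.1 hT' with rfl | h'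
        · exact absurd rfl hne
        · exact hsep0 T' h'
        · intro X hX Y hY hXY
          exact hsep0 T h Y hY X hX (MayerExpansion.overlap_symm (suppΩ idx Θ) _ _ hXY)
        · exact hsep' T h T' h' hne
      · rw [Finset.image_insert, hUT₀, himg']
    -- the bijection  𝒯 ↦ (T₀, 𝒯 ∖ T₀)
    have hbij : ∑ 𝒯 ∈ FibY idx Θ Pol (insert Y₀ 𝒴), ∏ T ∈ 𝒯, g T =
        ∑ p ∈ coversY idx Θ Pol Y₀ ×ˢ FibY idx Θ Pol 𝒴, g p.1 * ∏ T ∈ p.2, g T := by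
      refine Finset.sum_nbij' (fun 𝒯 => (theUY idx 𝒯 Y₀, 𝒯.erase (theUY idx 𝒯 Y₀)))
        (fun p => insert p.1 p.2) ?_ ?_ ?_ ?_ ?_
      · -- into the product
        intro 𝒯 h𝒯
        obtain ⟨hadm, himg⟩ := mem_FibY.1 h𝒯
        obtain ⟨hsub, hconn, hsep⟩ := mem_admissible.1 hadm
        obtain ⟨T₀, hT₀, hUT₀⟩ := Finset.mem_image.1 (himg.symm ▸ Finset.mem_insert_self Y₀ 𝒴)
        rw [theUY_eq hsupp hadm hT₀ hUT₀, Finset.mem_product]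
        refine ⟨mem_coversY.2 ⟨hsub T₀ hT₀, hconn T₀ hT₀, hUT₀⟩,
          mem_FibY.2 ⟨admissible_mono (Finset.erase_subset _ _) hadm, ?_⟩⟩
        ext Y
        rw [Finset.mem_image]
        constructor
        · rintro ⟨T, hT, rfl⟩
          obtain ⟨hTne, hT𝒯⟩ := Finset.mem_erase.1 hT
          have hUT : UY idx T ∈ insert Y₀ 𝒴 := himg ▸ Finset.mem_image_of_mem _ hT𝒯
          rcases Finset.mem_insert.1 hUT with h | h
          · exact absurd (UY_injOn hsupp hadm hT𝒯 hT₀ (h.trans hUT₀.symm)) hTne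
          · exact h
        · intro hY
          have hY' : Y ∈ insert Y₀ 𝒴 := Finset.mem_insert_of_mem hY
          rw [← himg, Finset.mem_image] at hY'
          obtain ⟨T, hT, hUT⟩ := hY'
          refine ⟨T, Finset.mem_erase.2 ⟨?_, hT⟩, hUT⟩
          rintro rfl
          exact hY₀ ((hUT.symm.trans hUT₀).symm ▸ hY)
      · -- from the product
        intro p hp; exact hins p hp
      · -- left inverse
        intro 𝒯 h𝒯
        obtain ⟨hadm, himg⟩ := mem_FibY.1 h𝒯
        obtain ⟨T₀, hT₀, hUT₀⟩ := Finset.mem_image.1 (himg.symm ▸ Finset.mem_insert_self Y₀ 𝒴)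
        simp only [theUY_eq hsupp hadm hT₀ hUT₀]
        exact Finset.insert_erase hT₀
      · -- right inverse
        rintro ⟨T₀, 𝒯'⟩ hp
        obtain ⟨hT₀, h𝒯'⟩ := Finset.mem_product.1 hp
        obtain ⟨_, _, hUT₀⟩ := mem_coversY.1 hT₀
        obtain ⟨hadm', himg'⟩ := mem_FibY.1 h𝒯'
        have hT₀notin : T₀ ∉ 𝒯' := by
          intro h
          have : UY idx T₀ ∈ 𝒴 := himg' ▸ Finset.mem_image_of_mem _ h
          exact hY₀ (hUT₀ ▸ this)
        have hadm_ins : insert T₀ 𝒯' ∈ admissible (MayerExpansion.Overlap (suppΩ idx Θ)) Pol := (mem_FibY.1 (hins _ hp)).1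
        simp only [theUY_eq hsupp hadm_ins (Finset.mem_insert_self T₀ 𝒯') hUT₀, Finset.erase_insert hT₀notin]
      · -- the summands agree
        intro 𝒯 h𝒯
        obtain ⟨hadm, himg⟩ := mem_FibY.1 h𝒯
        obtain ⟨T₀, hT₀, hUT₀⟩ := Finset.mem_image.1 (himg.symm ▸ Finset.mem_insert_self Y₀ 𝒴)
        simp only [theUY_eq hsupp hadm hT₀ hUT₀]
        exact (Finset.mul_prod_erase 𝒯 g hT₀).symm
    rw [hbij, Finset.sum_product, Finset.prod_insert hY₀, ← ih hdisj', KY, Finset.sum_mul_sum]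

/-- **THE REGROUPED SUM IN THE PRINTED INDEXING**: `Σ_{𝒯 admissible} Π_{T∈𝒯} g(T) = Σ_{{Y_j} ∈ famDY} Π_j K_g(Y_j)` — summing
over the fibres of `𝒯 ↦ {∪T : T ∈ 𝒯}` and evaluating each fibre by `sum_FibY_eq_prod_KY`.
[cite: Dimock2013BalabanII, App. F Theorem cluster3, proof (arXiv:1212.5562v2 TeX L7016–7039)] -/
theorem sum_admissible_eq_sum_famDY (hsupp : ∀ X ∈ Pol, (idx X \ Θ).Nonempty) {R : Type*} [CommSemiring R]
    (g : Finset P → R) :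
    ∑ 𝒯 ∈ admissible (MayerExpansion.Overlap (suppΩ idx Θ)) Pol, ∏ T ∈ 𝒯, g T =
      ∑ 𝒴 ∈ famDY idx Θ Pol, ∏ Y ∈ 𝒴, KY idx Θ Pol g Y := by
  have hmaps : ∀ 𝒯 ∈ admissible (MayerExpansion.Overlap (suppΩ idx Θ)) Pol, 𝒯.image (UY idx) ∈ famDY idx Θ Pol := by
    intro 𝒯 h𝒯
    obtain ⟨hsub, hconn, hsep⟩ := mem_admissible.1 h𝒯
    refine mem_famDY.2 ⟨?_, ?_, ?_⟩
    · intro Y hY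
      obtain ⟨T, hT, rfl⟩ := Finset.mem_image.1 hY
      exact Finset.mem_image.2 ⟨T, Finset.mem_powerset.2 (hsub T hT), rfl⟩
    · intro Y hY Y' hY' hne
      obtain ⟨T, hT, rfl⟩ := Finset.mem_image.1 hY
      obtain ⟨T', hT', rfl⟩ := Finset.mem_image.1 hY'
      have hTT' : T ≠ T' := fun h => hne (h ▸ rfl)
      exact disjoint_UY_iff.2 (hsep T hT T' hT' hTT')
    · intro Y hY
      obtain ⟨T, hT, rfl⟩ := Finset.mem_image.1 hY
      exact UY_sdiff_nonempty hsupp (hsub T hT) (hconn T hT).1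
  rw [← Finset.sum_fiberwise_of_maps_to hmaps]
  refine Finset.sum_congr rfl fun 𝒴 h𝒴 => ?_
  exact sum_FibY_eq_prod_KY hsupp g 𝒴 (mem_famDY.1 h𝒴).2.1

/-- **STEP 1 IN THE PRINTED INDEXING** (L7025–7034): `Π_{X∈Pol}(1 + a_X) = Σ_{{Y_j}} Π_j K(Y_j)` over the families of
unions with pairwise disjoint non-empty Ω-parts, `K(Y) = Σ_{{X_i} Ω-connected: ∪X_i = Y} Π_i a_{X_i}` (Ω-supports non-empty
on `Pol`). [cite: Dimock2013BalabanII, App. F Theorem cluster3, proof (arXiv:1212.5562v2 TeX L7016–7034)] -/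
theorem mayer_expansionY (hsupp : ∀ X ∈ Pol, (idx X \ Θ).Nonempty) {R : Type*} [CommSemiring R] (a : P → R) :
    ∏ X ∈ Pol, (1 + a X) = ∑ 𝒴 ∈ famDY idx Θ Pol, ∏ Y ∈ 𝒴, KY idx Θ Pol (fun T => ∏ X ∈ T, a X) Y :=
  (prod_one_add_eq_sum_admissible (MayerExpansion.overlap_symm (suppΩ idx Θ)) Pol a).trans (sum_admissible_eq_sum_famDY hsupp _)

/-- **`exp(Σ_X H(X)) = Σ_{{Y_j}} Π_j K(Y_j)`**, `K(Y) = Σ_{{X_i}: ∪X_i = Y} Π_i(e^{H(X_i)} − 1)` — real weights (L7025–7029 at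
a fixed field). [cite: Dimock2013BalabanII, App. F Theorem cluster3, proof (arXiv:1212.5562v2 TeX L7025–7034)] -/
theorem exp_sum_eq_mayerY (hsupp : ∀ X ∈ Pol, (idx X \ Θ).Nonempty) (H : P → ℝ) :
    Real.exp (∑ X ∈ Pol, H X) =
      ∑ 𝒴 ∈ famDY idx Θ Pol, ∏ Y ∈ 𝒴, KY idx Θ Pol (fun T => ∏ X ∈ T, (Real.exp (H X) - 1)) Y := by
  rw [Real.exp_sum, ← mayer_expansionY hsupp]
  exact Finset.prod_congr rfl fun X _ => by ring

/-- the same with complex weights. [cite: Dimock2013BalabanII, App. F Theorem cluster3, proof (arXiv:1212.5562v2 TeX L7025–7034)] -/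
theorem cexp_sum_eq_mayerY (hsupp : ∀ X ∈ Pol, (idx X \ Θ).Nonempty) (H : P → ℂ) :
    Complex.exp (∑ X ∈ Pol, H X) =
      ∑ 𝒴 ∈ famDY idx Θ Pol, ∏ Y ∈ 𝒴, KY idx Θ Pol (fun T => ∏ X ∈ T, (Complex.exp (H X) - 1)) Y := by
  rw [Complex.exp_sum, ← mayer_expansionY hsupp]
  exact Finset.prod_congr rfl fun X _ => by ring

/-! ### The hard-core gas of the unions: incompatibility `Y ∩ Y′ ∩ Ω ≠ ∅` -/

/-- THE HARD CORE OF THE REGROUPED GAS (L7038–7039: distinct `Y_j ∩ Ω` disjoint): `Y ι Y′ :⟺ (Y ∩ Ω) ∩ (Y′ ∩ Ω) ≠ ∅`, made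
reflexive (`∨ Y = Y′`) for the abstract Kotecký–Preiss layer. [cite: Dimock2013BalabanII, App. F Theorem cluster3, proof (arXiv:1212.5562v2 TeX L7035–7039, L7063–7073)] -/
def IncΩ (Θ : Finset C) : Finset C → Finset C → Prop := fun Y Y' => ¬ Disjoint (Y \ Θ) (Y' \ Θ) ∨ Y = Y'

/-- the hard core is decidable. [cite: Dimock2013BalabanII, App. F Theorem cluster3, proof (arXiv:1212.5562v2 TeX L7035–7039)] -/
instance (Θ : Finset C) : DecidableRel (IncΩ Θ) := fun Y Y' => by unfold IncΩ; infer_instance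

/-- the hard core is reflexive. [cite: Dimock2013BalabanII, App. F Theorem cluster3, proof (arXiv:1212.5562v2 TeX L7035–7039)] -/
instance (Θ : Finset C) : Std.Refl (IncΩ Θ) := ⟨fun _ => Or.inr rfl⟩

/-- the hard core is symmetric. [cite: Dimock2013BalabanII, App. F Theorem cluster3, proof (arXiv:1212.5562v2 TeX L7035–7039)] -/
instance (Θ : Finset C) : Std.Symm (IncΩ Θ) :=
  ⟨fun _ _ h => h.elim (fun h => Or.inl fun h' => h h'.symm) fun h => Or.inr h.symm⟩

omit [DecidableEq P] in
/-- for distinct unions, compatible = Ω-disjoint. [cite: Dimock2013BalabanII, App. F Theorem cluster3, proof (arXiv:1212.5562v2 TeX L7035–7039)] -/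
theorem not_incΩ_iff {Y Y' : Finset C} (hne : Y ≠ Y') : ¬ IncΩ Θ Y Y' ↔ Disjoint (Y \ Θ) (Y' \ Θ) := by
  simp [IncΩ, hne]

/-- THE POLYMERS OF THE REGROUPED GAS: the unions `Y = ∪_i X_i` of sub-collections of `Pol` meeting `Ω`.
[cite: Dimock2013BalabanII, App. F Theorem cluster3, proof (arXiv:1212.5562v2 TeX L7021–7039)] -/
def unionsY (idx : P → Finset C) (Θ : Finset C) (Pol : Finset P) : Finset (Finset C) :=
  (Pol.powerset.image (UY idx)).filter fun Y => (Y \ Θ).Nonempty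

omit [DecidableEq P] in
/-- `famDY` = the compatible sub-families of `unionsY` for the hard core `IncΩ`. [cite: Dimock2013BalabanII, App. F Theorem cluster3, proof (arXiv:1212.5562v2 TeX L7025–7039)] -/
theorem mem_famDY_iff_isCompatible {𝒴 : Finset (Finset C)} :
    𝒴 ∈ famDY idx Θ Pol ↔ 𝒴 ⊆ unionsY idx Θ Pol ∧ IsCompatible (IncΩ Θ) 𝒴 := by
  rw [mem_famDY]
  constructor
  · rintro ⟨hsub, hdisj, hne⟩
    refine ⟨fun Y hY => Finset.mem_filter.2 ⟨hsub Y hY, hne Y hY⟩, ?_⟩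
    intro Y hY Y' hY' hYY'
    exact fun h => h.elim (fun h => h (hdisj Y hY Y' hY' hYY')) fun h => hYY' h
  · rintro ⟨hsub, hcomp⟩
    refine ⟨fun Y hY => (Finset.mem_filter.1 (hsub hY)).1, ?_, fun Y hY => (Finset.mem_filter.1 (hsub hY)).2⟩
    intro Y hY Y' hY' hne
    exact (not_incΩ_iff hne).1 (hcomp hY hY' hne)

omit [DecidableEq P] in
/-- **the regrouped sum IS the hard-core partition function of the gas of unions, for any activity `w`**: `Σ_{{Y_j}∈famDY}
Π_j w(Y_j) = Ξ_{unionsY}(w)` (`LatticeModels.polymerPartitionFunction`). [cite: Dimock2013BalabanII, App. F Theorem cluster3, proof (arXiv:1212.5562v2 TeX L7025–7039, L7063–7073)] -/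
theorem sum_famDY_prod_eq_polymerPartitionFunction (w : Finset C → ℂ) :
    ∑ 𝒴 ∈ famDY idx Θ Pol, ∏ Y ∈ 𝒴, w Y = polymerPartitionFunction (IncΩ Θ) w (unionsY idx Θ Pol) := by
  unfold polymerPartitionFunction
  rw [← Finset.sum_filter]
  refine Finset.sum_congr ?_ fun _ _ => rfl
  ext 𝒴
  rw [mem_famDY_iff_isCompatible, Finset.mem_filter, Finset.mem_powerset]

/-! ### `H^#(Y)` over an arbitrary finite volume of unions, exponentiation, local influence, zero activities -/

/-- **`H^#(Y)`** (L7068–7072: *"H^#(Y) = Σ_n (1/n!) Σ_{(Y_1,…,Y_n): ∪_i Y_i = Y} ρ^T(Y_1,…,Y_n) Π_i K(Y_i)"*), in the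
Kotecký–Preiss form of the tree: the sum of the truncated functionals `Φ^T(𝒞)` over the sub-families `𝒞` of a finite
volume `L` of unions with `∪𝒞 = Y`. [cite: Dimock2013BalabanII, App. F Theorem cluster3, proof (arXiv:1212.5562v2 TeX L7063–7073)] -/
def HsharpL (Θ : Finset C) (L : Finset (Finset C)) (w : Finset C → ℂ) (Y : Finset C) : ℂ :=
  ∑ 𝒞 ∈ L.powerset with 𝒞.biUnion id = Y, truncatedWeight (IncΩ Θ) w 𝒞

omit [DecidableEq P] in
/-- regrouping the cluster sum by unions: `Σ_{𝒞 ⊆ L} Φ^T(𝒞) = Σ_Y H^#(Y)`. [cite: Dimock2013BalabanII, App. F Theorem cluster3, proof (arXiv:1212.5562v2 TeX L7063–7073)] -/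
theorem sum_truncatedWeight_eq_sum_HsharpL (L : Finset (Finset C)) (w : Finset C → ℂ) :
    ∑ 𝒞 ∈ L.powerset, truncatedWeight (IncΩ Θ) w 𝒞 =
      ∑ Y ∈ L.powerset.image (fun 𝒞 => 𝒞.biUnion id), HsharpL Θ L w Y := by
  rw [← Finset.sum_fiberwise_of_maps_to (g := fun 𝒞 : Finset (Finset C) => 𝒞.biUnion id)
    (t := L.powerset.image fun 𝒞 => 𝒞.biUnion id) fun 𝒞 h𝒞 => Finset.mem_image_of_mem _ h𝒞]
  rfl

omit [DecidableEq P] in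
/-- **EXPONENTIATION** (L7063–7066: *"Next we exponentiate the sum and get  Σ_{{Y_j}} Π_j K^#(Y_j) = exp( Σ_Y H^#(Y) )"*) by
the tree's Kotecký–Preiss theorem: in any finite volume `L` of unions where the activities obey the KP condition,
`Ξ_L(w) = exp(Σ_Y H^#(Y))`. [cite: Dimock2013BalabanII, App. F Theorem cluster3, proof (arXiv:1212.5562v2 TeX L7063–7077)] -/
theorem polymerPartitionFunction_eq_cexp_sum_HsharpL {L : Finset (Finset C)} {w : Finset C → ℂ}
    {a : Finset C → ℝ} (hKP : IsKPVolume (IncΩ Θ) w a L) :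
    polymerPartitionFunction (IncΩ Θ) w L =
      Complex.exp (∑ Y ∈ L.powerset.image (fun 𝒞 => 𝒞.biUnion id), HsharpL Θ L w Y) := by
  rw [← sum_truncatedWeight_eq_sum_HsharpL, ← polymerLogZ_eq_sum_truncatedWeight, exp_polymerLogZ_of_kp hKP subset_rfl]

omit [DecidableEq P] in
/-- **THE LOCAL INFLUENCE PROPERTY** — [Dimock2013BalabanII] App. F, verbatim (L7000): *"In addition H^#(Y) only depends on
H(X) for X ⊂ Y. We call this the local influence property of the cluster expansion."* — at the level of the activities:
`H^#(Y)` only depends on the `K(Y′)`, `Y′ ⊆ Y` (each `Φ^T(𝒞)` with `∪𝒞 = Y` only involves members `Y′ ⊆ Y`; tree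
`truncatedWeight_congr`); and `K(Y′)` only involves `H(X)` for `X ⊆ Y′` by its definition.
[cite: Dimock2013BalabanII, App. F Theorem cluster3, remark (arXiv:1212.5562v2 TeX L7000)] -/
theorem HsharpL_congr_local {L : Finset (Finset C)} {w w' : Finset C → ℂ} {Y : Finset C}
    (h : ∀ Y' ∈ L, Y' ⊆ Y → w Y' = w' Y') : HsharpL Θ L w Y = HsharpL Θ L w' Y := by
  unfold HsharpL
  refine Finset.sum_congr rfl fun 𝒞 h𝒞 => ?_
  obtain ⟨h𝒞L, hU⟩ := Finset.mem_filter.1 h𝒞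
  rw [Finset.mem_powerset] at h𝒞L
  refine truncatedWeight_congr fun Y' hY' => h Y' (h𝒞L hY') ?_
  rw [← hU]
  exact Finset.subset_biUnion_of_mem id hY'

omit [DecidableEq P] in
/-- Polymers with ZERO activity drop out of a hard-core partition function: if `w = 0` on `Λ ∖ Λ′` then `Ξ_Λ(w) =
Ξ_{Λ′}(w)` (the terms of `Ξ_Λ` through a zero-activity polymer vanish). [folklore] -/
private theorem polymerPartitionFunction_eq_of_zero_off {Q : Type*} [DecidableEq Q] (inc : Q → Q → Prop) [DecidableRel inc]
    {w : Q → ℂ} {Λ Λ' : Finset Q} (hsub : Λ' ⊆ Λ) (hzero : ∀ γ ∈ Λ, γ ∉ Λ' → w γ = 0) :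
    polymerPartitionFunction inc w Λ = polymerPartitionFunction inc w Λ' := by
  unfold polymerPartitionFunction
  symm
  refine Finset.sum_subset (Finset.powerset_mono.2 hsub) fun A hA hA' => ?_
  rw [Finset.mem_powerset] at hA
  have hγ : ∃ γ ∈ A, γ ∉ Λ' := by
    by_contra h
    simp only [not_exists, not_and, not_not] at h
    exact hA' (Finset.mem_powerset.2 fun γ hγ => h γ hγ)
  obtain ⟨γ, hγA, hγΛ'⟩ := hγ
  split_ifs
  · exact Finset.prod_eq_zero hγA (hzero γ (hA hγA) hγΛ')
  · rfl

end Regroup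

/-! ## Part 2. Ω-connected unions on the torus: their geometry, and (simplon) with the printed decay length -/

section Torus

variable {d N : ℕ} [NeZero N]

omit [NeZero N] in
/-- chains inside a family are chains inside every larger family. [folklore] -/
private theorem tLinked_mono' {S S' : Finset (TPt d N)} (hSS' : S ⊆ S') {x y : TPt d N} (h : TLinked S x y) :
    TLinked S' x y := by
  unfold TLinked at *
  induction h with
  | refl => exact Relation.ReflTransGen.refl
  | tail _ hbc ih => exact Relation.ReflTransGen.tail ih ⟨hSS' hbc.1, hSS' hbc.2.1, hbc.2.2⟩

omit [NeZero N] in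
/-- **an Ω-connected family of face-connected polymers has a face-connected union** (the polymers `Y = ∪_i X_i` of L7022
are again localization domains: members linked through a common cube outside the holes chain their cubes together).
[cite: Dimock2013BalabanII, App. F Theorem cluster3, proof (arXiv:1212.5562v2 TeX L7016–7027)] -/
theorem tFaceConnected_biUnion {Θ : Finset (TPt d N)} {T : Finset (Finset (TPt d N))}
    (hfc : ∀ X ∈ T, TFaceConnected X)
    (hT : IsConnColl (MayerExpansion.Overlap fun X : Finset (TPt d N) => X \ Θ) T) :
    TFaceConnected (T.biUnion id) := by
  classical
  have hsubY : ∀ W ∈ T, W ⊆ T.biUnion id := fun W hW => Finset.subset_biUnion_of_mem id hW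
  intro x hx y hy
  obtain ⟨Zx, hZxT, hxZ⟩ := Finset.mem_biUnion.1 hx
  obtain ⟨Zy, hZyT, hyZ⟩ := Finset.mem_biUnion.1 hy
  set T₁ := T.filter fun W => ∀ w ∈ W, TLinked (T.biUnion id) x w with hT₁
  have hZx1 : Zx ∈ T₁ :=
    Finset.mem_filter.2 ⟨hZxT, fun w hw => tLinked_mono' (hsubY Zx hZxT) (hfc Zx hZxT x hxZ w hw)⟩
  have hall : T₁ = T := by
    by_contra hne
    obtain ⟨W₁, hW₁, W₂, hW₂, hov⟩ :=
      (isConnColl_iff_noSplit hT.1).1 hT T₁ (Finset.filter_subset _ _) ⟨Zx, hZx1⟩ hne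
    obtain ⟨hW₂T, hW₂not⟩ := Finset.mem_sdiff.1 hW₂
    apply hW₂not
    refine Finset.mem_filter.2 ⟨hW₂T, fun w hw => ?_⟩
    obtain ⟨c, hc⟩ := hov
    rw [Finset.mem_inter, Finset.mem_sdiff, Finset.mem_sdiff] at hc
    exact Relation.ReflTransGen.trans ((Finset.mem_filter.1 hW₁).2 c hc.1.1)
      (tLinked_mono' (hsubY W₂ hW₂T) (hfc W₂ hW₂T c hc.2.1 w hw))
  have hZy1 : Zy ∈ T₁ := by rw [hall]; exact hZyT
  exact (Finset.mem_filter.1 hZy1).2 y hyZ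

omit [NeZero N] in
/-- a union of localization domains `mod Θ` is a localization domain `mod Θ` (each hole component is inside or outside
every member, hence inside or outside the union). [cite: Dimock2013BalabanII, App. F Theorem cluster3 (arXiv:1212.5562v2 TeX L6984–6988)] -/
theorem dMod_biUnion {Θ : Finset (TPt d N)} {T : Finset (Finset (TPt d N))} (h : ∀ X ∈ T, DMod Θ X) :
    DMod Θ (T.biUnion id) := by
  intro a ha b hb hab
  simp only [Finset.mem_biUnion, id]
  constructor
  · rintro ⟨X, hX, haX⟩
    exact ⟨X, hX, (h X hX a ha b hb hab).1 haX⟩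
  · rintro ⟨X, hX, hbX⟩
    exact ⟨X, hX, (h X hX a ha b hb hab).2 hbX⟩

/-- **THE GEOMETRY OF A REGROUPED POLYMER**: the union `Y` of an Ω-connected cover by polymers with holes is non-empty,
face-connected, a localization domain `mod Θ`, meets `Ω`, and its class of graphs (inside `Y`, meeting every cube of `Y ∩
Ω`) is non-empty (`HolePolymerKeyBounds.exists_tAdmissibleMod_biUnion`) — so `d_M(Y, mod Ω^c)` is a genuine infimum and
(keykey2) applies to it. [cite: Dimock2013BalabanII, App. F Theorem cluster3, proof (arXiv:1212.5562v2 TeX L7011–7014, L7016–7027)] -/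
theorem geom_of_mem_coversY (Θ : Finset (TPt d N)) {Pol : Finset (Finset (TPt d N))}
    (hPol : ∀ X ∈ Pol, X.Nonempty ∧ TFaceConnected X ∧ DMod Θ X ∧ (X \ Θ).Nonempty)
    {Y : Finset (TPt d N)} {T : Finset (Finset (TPt d N))} (hT : T ∈ coversY id Θ Pol Y) :
    Y.Nonempty ∧ TFaceConnected Y ∧ DMod Θ Y ∧ (Y \ Θ).Nonempty ∧ ∃ G, TCover Y (Y \ Θ) G := by
  obtain ⟨hTP, hconn, hU⟩ := mem_coversY.1 hT
  have hU' : T.biUnion id = Y := hU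
  have hconn' : IsConnColl (MayerExpansion.Overlap fun X : Finset (TPt d N) => X \ Θ) T := hconn
  have hcl : ∀ X ∈ T, ∃ G, TAdmissibleMod X Θ G := fun X hX => by
    obtain ⟨h1, h2, -, -⟩ := hPol X (hTP hX)
    exact exists_tCover_of_dom h1 h2 (Finset.Subset.refl X) Finset.sdiff_subset
  have hΩ : (Y \ Θ).Nonempty := by
    rw [← hU']
    exact UY_sdiff_nonempty (idx := id) (Θ := Θ) (fun X hX => (hPol X hX).2.2.2) hTP hconn.1
  refine ⟨hΩ.mono Finset.sdiff_subset, ?_, ?_, hΩ, ?_⟩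
  · rw [← hU']
    exact tFaceConnected_biUnion (fun X hX => (hPol X (hTP hX)).2.1) hconn'
  · rw [← hU']
    exact dMod_biUnion fun X hX => (hPol X (hTP hX)).2.2.1
  · obtain ⟨G, hG⟩ :=
      exists_tAdmissibleMod_biUnion Θ hconn.1 hcl ((omegaConnected_iff_isConnColl hconn.1).2 hconn')
    refine ⟨G, ?_⟩
    have hG' : TCover (T.biUnion id) (T.biUnion id \ Θ) G := hG
    rwa [hU'] at hG'

/-- **(simplon) WITH THE PRINTED DECAY LENGTH** — [Dimock2013BalabanII] App. F, verbatim (L7046–7049): *"|K(Y)| ≤ 𝒪(1) H_0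
e^{−(κ − κ_0 − 2) d_M(Y, mod Ω^c)}"* (the print's `𝒪(1)` carries no `κ_0`; here the constant is explicit, with a factor `κ₀`)
— PROVED on the torus for the `K(Y)` of the printed indexing (`KY`): the
part I kernel `ClusterActivityBound.norm_clusterSum_le_final` fed with (clams) = `HolePolymerKeyBounds.lemma_otter` (the
covers are Ω-connected with union `Y`, so `d_M(Y, mod Θ) ≤ Σ d_M(X_i, mod Θ) + (n−1)` — the printed (otter), no Ω-part
detour), (sudsy) = `lemma_keykey1` over the members `X ⊆ Y`, (ninety) = (keykey2) `ResummationOperation.card_sdiff_le_torusTreeLenMod` for `Y`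
(class non-empty by `geom_of_mem_coversY`).  Constants: `𝒪(1) = 2e·K₁(d)`, for `max(κ₁(d), 4·2^d) ≤ κ₀ ≤ κ`, activities
`‖a(X)‖ ≤ 2H₀e^{−κ d_M(X, mod Θ)}` on `Pol`, smallness `2H₀K₁(d)κ₀e^{κ−κ₀} ≤ 1`.
[cite: Dimock2013BalabanII, App. F Theorem cluster3, proof eq. (simplon) (arXiv:1212.5562v2 TeX L7041–7049)] -/
theorem norm_KY_le {𝕜 : Type*} [NormedField 𝕜] (Θ : Finset (TPt d N)) {Pol : Finset (Finset (TPt d N))}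
    (hPol : ∀ X ∈ Pol, X.Nonempty ∧ TFaceConnected X ∧ DMod Θ X ∧ (X \ Θ).Nonempty)
    {a : Finset (TPt d N) → 𝕜} {κ κ₀ H₀ : ℝ} (hκ₁ : kappa₁ d ≤ κ₀) (hκv : 4 * 2 ^ d ≤ κ₀) (hκ : κ₀ ≤ κ)
    (hH₀ : 0 ≤ H₀) (ha : ∀ X ∈ Pol, ‖a X‖ ≤ 2 * H₀ * Real.exp (-κ * torusTreeLenMod X Θ))
    (hsmall₁ : 2 * H₀ * K₁ d * κ₀ * Real.exp (κ - κ₀) ≤ 1) (Y : Finset (TPt d N)) :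
    ‖KY id Θ Pol (fun T => ∏ X ∈ T, a X) Y‖ ≤
      2 * Real.exp 1 * K₁ d * κ₀ * H₀ * Real.exp (-(κ - κ₀ - 2) * torusTreeLenMod Y Θ) := by
  classical
  have hκ₀ : 0 ≤ κ₀ := le_trans (by positivity) hκv
  have hK₁ := K₁_pos d
  by_cases hcov : coversY id Θ Pol Y = ∅
  · unfold KY
    rw [hcov, Finset.sum_empty, norm_zero]
    positivity
  obtain ⟨T₀, hT₀⟩ := Finset.nonempty_iff_ne_empty.2 hcov
  obtain ⟨-, -, -, -, hcl⟩ := geom_of_mem_coversY Θ hPol hT₀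
  unfold KY
  refine ClusterActivityBound.norm_clusterSum_le_final (Q := Pol.filter fun X => X ⊆ Y)
    (d := fun X => torusTreeLenMod X Θ) (vY := ((Y \ Θ).card : ℝ)) (c := 1) (c₀ := H₀) (K₀ := K₁ d)
    hκ hH₀ (torusTreeLenMod_nonneg Y Θ) hK₁.le hκ₀ ?_ ?_ ?_ ?_ ?_ le_rfl (by rwa [one_mul])
  · -- the covers consist of members inside `Y` and are non-empty
    intro T hT
    obtain ⟨hTP, hconn, hU⟩ := mem_coversY.1 hT
    refine ⟨fun X hX => Finset.mem_filter.2 ⟨hTP hX, ?_⟩, hconn.1⟩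
    have hU' : T.biUnion id = Y := hU
    rw [← hU']
    exact Finset.subset_biUnion_of_mem id hX
  · -- (clams) = (otter) for the Ω-connected cover
    intro T hT
    obtain ⟨hTP, hconn, hU⟩ := mem_coversY.1 hT
    have hconn' : IsConnColl (MayerExpansion.Overlap fun X : Finset (TPt d N) => X \ Θ) T := hconn
    have hclT : ∀ X ∈ T, ∃ G, TAdmissibleMod X Θ G := fun X hX => by
      obtain ⟨h1, h2, -, -⟩ := hPol X (hTP hX)
      exact exists_tCover_of_dom h1 h2 (Finset.Subset.refl X) Finset.sdiff_subset
    have h := lemma_otter_of_isConnColl Θ hclT hconn'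
    have hU' : T.biUnion id = Y := hU
    rw [hU'] at h
    simpa only [one_mul] using h
  · -- the activities on the members inside `Y`
    intro X hX
    exact ha X (Finset.mem_filter.1 hX).1
  · -- (sudsy) = (keykey1) over the members `X ⊆ Y`
    have hsub : (Pol.filter fun X => X ⊆ Y) ⊆ Pol.filter fun X => ((X ∩ Y) \ Θ).Nonempty := by
      intro X hX
      obtain ⟨hXP, hXY⟩ := Finset.mem_filter.1 hX
      refine Finset.mem_filter.2 ⟨hXP, ?_⟩
      rw [Finset.inter_eq_left.2 hXY]
      exact (hPol X hXP).2.2.2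
    refine (Finset.sum_le_sum_of_subset_of_nonneg hsub fun _ _ _ => (Real.exp_pos _).le).trans ?_
    exact lemma_keykey1 Θ Y Pol (fun X hX => let h := hPol X hX; ⟨h.1, h.2.1, h.2.2.1⟩) hκ₁
  · -- (ninety) = (keykey2) for `Y`
    have h := ResummationOperation.card_sdiff_le_torusTreeLenMod hcl
    have hℓ := torusTreeLenMod_nonneg Y Θ
    have hprod := mul_nonneg (sub_nonneg.2 hκv) (by linarith : (0 : ℝ) ≤ 1 + torusTreeLenMod Y Θ)
    have h2 : (0 : ℝ) ≤ 2 ^ d := by positivity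
    nlinarith

/-! ## Part 3. The Kotecký–Preiss condition of the gas of unions, with the printed size and decay -/

/-- THE Ω-CONNECTED UNIONS: the members of the regrouped gas carrying a non-zero `K` — unions of Ω-connected covers
from `Pol` (off them `K(Y) = 0`, `KY_eq_zero_of_not_mem`). [cite: Dimock2013BalabanII, App. F Theorem cluster3, proof (arXiv:1212.5562v2 TeX L7016–7034)] -/
def cunions (Θ : Finset (TPt d N)) (Pol : Finset (Finset (TPt d N))) : Finset (Finset (TPt d N)) :=
  (unionsY id Θ Pol).filter fun Y => (coversY id Θ Pol Y).Nonempty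

/-- Kotecký–Preiss SIZE of a union: `a(Y) = θ·|Y ∩ Ω|` (the printed `|Y′ ∩ Ω|_M` of (keykey2), L7012).
[cite: Dimock2013BalabanII, App. F Theorem cluster3, proof (arXiv:1212.5562v2 TeX L7011–7014, L7076–7077)] -/
def kpSizeΩ (θ : ℝ) (Θ Y : Finset (TPt d N)) : ℝ := θ * ((Y \ Θ).card : ℝ)

/-- Kotecký–Preiss DECAY of a union: `d(Y) = δ·(d_M(Y, mod Ω^c) + 1)` — the printed decay length.
[cite: Dimock2013BalabanII, App. F Theorem cluster3 eq. (sunshine) (arXiv:1212.5562v2 TeX L6994–6996)] -/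
def kpDecayΩ (δ : ℝ) (Θ Y : Finset (TPt d N)) : ℝ := δ * (torusTreeLenMod Y Θ + 1)

omit [NeZero N] in
/-- membership in the Ω-connected unions. [cite: Dimock2013BalabanII, App. F Theorem cluster3, proof (arXiv:1212.5562v2 TeX L7016–7034)] -/
theorem mem_cunions {Θ : Finset (TPt d N)} {Pol : Finset (Finset (TPt d N))} {Y : Finset (TPt d N)} :
    Y ∈ cunions Θ Pol ↔ Y ∈ unionsY id Θ Pol ∧ (coversY id Θ Pol Y).Nonempty := Finset.mem_filter

omit [NeZero N] in
/-- the Ω-connected unions are among the unions. [cite: Dimock2013BalabanII, App. F Theorem cluster3, proof (arXiv:1212.5562v2 TeX L7016–7034)] -/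
theorem cunions_subset (Θ : Finset (TPt d N)) (Pol : Finset (Finset (TPt d N))) :
    cunions Θ Pol ⊆ unionsY id Θ Pol := Finset.filter_subset _ _

/-- the geometry of an Ω-connected union (`geom_of_mem_coversY`). [cite: Dimock2013BalabanII, App. F Theorem cluster3, proof (arXiv:1212.5562v2 TeX L7011–7027)] -/
theorem geom_of_mem_cunions (Θ : Finset (TPt d N)) {Pol : Finset (Finset (TPt d N))}
    (hPol : ∀ X ∈ Pol, X.Nonempty ∧ TFaceConnected X ∧ DMod Θ X ∧ (X \ Θ).Nonempty)
    {Y : Finset (TPt d N)} (hY : Y ∈ cunions Θ Pol) :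
    Y.Nonempty ∧ TFaceConnected Y ∧ DMod Θ Y ∧ (Y \ Θ).Nonempty ∧ ∃ G, TCover Y (Y \ Θ) G := by
  obtain ⟨T, hT⟩ := (mem_cunions.1 hY).2
  exact geom_of_mem_coversY Θ hPol hT

omit [NeZero N] in
/-- off the Ω-connected unions `K(Y) = 0` (no Ω-connected cover). [cite: Dimock2013BalabanII, App. F Theorem cluster3, proof (arXiv:1212.5562v2 TeX L7031–7034)] -/
theorem KY_eq_zero_of_not_mem {R : Type*} [AddCommMonoid R] {Θ : Finset (TPt d N)} {Pol : Finset (Finset (TPt d N))}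
    (g : Finset (Finset (TPt d N)) → R) {Y : Finset (TPt d N)} (hY : Y ∈ unionsY id Θ Pol)
    (hY' : Y ∉ cunions Θ Pol) : KY id Θ Pol g Y = 0 := by
  have h : coversY id Θ Pol Y = ∅ := by
    rw [← Finset.not_nonempty_iff_eq_empty]
    exact fun hne => hY' (mem_cunions.2 ⟨hY, hne⟩)
  unfold KY
  rw [h, Finset.sum_empty]

omit [NeZero N] in
/-- a union incompatible with `Y` meets `Y` in `Ω`. [cite: Dimock2013BalabanII, App. F Theorem cluster3, proof (arXiv:1212.5562v2 TeX L7035–7039)] -/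
theorem inter_sdiff_nonempty_of_incΩ {Θ Y Y' : Finset (TPt d N)} (hY : (Y \ Θ).Nonempty) (h : IncΩ Θ Y' Y) :
    ((Y' ∩ Y) \ Θ).Nonempty := by
  rcases h with hnd | heq
  · obtain ⟨c, hc1, hc2⟩ := Finset.not_disjoint_iff.1 hnd
    rw [Finset.mem_sdiff] at hc1 hc2
    exact ⟨c, Finset.mem_sdiff.2 ⟨Finset.mem_inter.2 ⟨hc1.1, hc2.1⟩, hc1.2⟩⟩
  · rw [heq, Finset.inter_self]
    exact hY

omit [NeZero N] in
/-- an `IncΩ`-cluster of unions is Ω-connected in the sense of `HolePolymerKeyBounds.OmegaConnected` (*"ρ^T(Y_1, …, Y_n)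
vanishes if the Y_j are not Ω-connected"*, L7073). [cite: Dimock2013BalabanII, App. F Theorem cluster3, proof (arXiv:1212.5562v2 TeX L7068–7073)] -/
theorem omegaConnected_of_isPolymerCluster {Θ : Finset (TPt d N)} {𝒞 : Finset (Finset (TPt d N))}
    (h : IsPolymerCluster (IncΩ Θ) 𝒞) : OmegaConnected Θ 𝒞 := by
  intro G hG hGne hGne'
  have hsd : (𝒞 \ G).Nonempty := by
    rw [Finset.nonempty_iff_ne_empty, Ne, Finset.sdiff_eq_empty_iff_subset]
    exact fun h' => hGne' (Finset.Subset.antisymm hG h')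
  obtain ⟨Y₁, hY₁, Y₂, hY₂, hinc⟩ := h G hG hGne hsd
  obtain ⟨hY₂𝒞, hY₂G⟩ := Finset.mem_sdiff.1 hY₂
  have hne : Y₁ ≠ Y₂ := fun h' => hY₂G (h' ▸ hY₁)
  rcases hinc with hnd | heq
  · obtain ⟨c, hc1, hc2⟩ := Finset.not_disjoint_iff.1 hnd
    rw [Finset.mem_sdiff] at hc1 hc2
    exact ⟨Y₁, hY₁, Y₂, hY₂𝒞, hY₂G, c, hc1.1, hc2.1, hc1.2⟩
  · exact absurd heq hne

/-- **(otter) FOR THE CLUSTERS OF THE GAS OF UNIONS**: for an `IncΩ`-cluster `𝒞` of Ω-connected unions and `δ ≥ 0`,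
`δ(d_M(∪𝒞, mod Θ) + 1) ≤ Σ_{Y′∈𝒞} δ(d_M(Y′, mod Θ) + 1)` — `HolePolymerKeyBounds.lemma_otter` (the `+1` per member
absorbs the printed `𝒪(1)(n − 1)`). [cite: Dimock2013BalabanII, App. F Theorem cluster3, proof eq. (otter) (arXiv:1212.5562v2 TeX L7041–7045, L7073–7077)] -/
theorem kpDecayΩ_biUnion_le_sum (Θ : Finset (TPt d N)) {Pol : Finset (Finset (TPt d N))}
    (hPol : ∀ X ∈ Pol, X.Nonempty ∧ TFaceConnected X ∧ DMod Θ X ∧ (X \ Θ).Nonempty)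
    {𝒞 : Finset (Finset (TPt d N))} (h𝒞ne : 𝒞.Nonempty) (h𝒞 : 𝒞 ⊆ cunions Θ Pol)
    (hcl : IsPolymerCluster (IncΩ Θ) 𝒞) {δ : ℝ} (hδ : 0 ≤ δ) :
    kpDecayΩ δ Θ (𝒞.biUnion id) ≤ ∑ Y' ∈ 𝒞, kpDecayΩ δ Θ Y' := by
  have hclass : ∀ Y' ∈ 𝒞, ∃ G, TAdmissibleMod Y' Θ G := fun Y' hY' =>
    (geom_of_mem_cunions Θ hPol (h𝒞 hY')).2.2.2.2
  have h := lemma_otter Θ h𝒞ne hclass (omegaConnected_of_isPolymerCluster hcl)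
  have hsum : ∑ Y' ∈ 𝒞, kpDecayΩ δ Θ Y' = δ * ∑ Y' ∈ 𝒞, torusTreeLenMod Y' Θ + δ * (𝒞.card : ℝ) := by
    simp only [kpDecayΩ, mul_add, mul_one, Finset.sum_add_distrib, Finset.sum_const, nsmul_eq_mul, Finset.mul_sum]
    ring
  rw [hsum]
  unfold kpDecayΩ
  nlinarith [mul_le_mul_of_nonneg_left h hδ]

/-- **THE KOTECKÝ–PREISS SUM FOR AN ACTIVITY WITH THE PRINTED (simplon) BOUND**: if `‖w(Y′)‖ ≤ 2eK₁(d)κ₀H₀e^{−(κ−κ₀−2)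
d_M(Y′, mod Θ)}` on the Ω-connected unions, `max(κ₁(d), 4·2^d) ≤ κ₀`, `H₀ ≥ 0`, `θ ≤ 1`, then for every Ω-connected union
`Y`, `Σ_{Y′: Y′∩Y∩Ω ≠ ∅} ‖w(Y′)‖·e^{θ|Y′∩Ω| + δ(d_M(Y′, mod Θ)+1)} ≤ θ|Y ∩ Ω|` — (keykey2) bounds `θ|Y′∩Ω| ≤ 4·2^d(1 +
d_M(Y′, mod Θ))`, the exponents collect to `e^{4·2^d+δ}e^{−κ₁(d)d_M(Y′, mod Θ)}`, and (keykey1) `lemma_keykey1` sums over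
the `Y′` meeting `Y ∩ Ω` (*"Σ_{Y ∩ Y′ ∩ Ω ≠ ∅} e^{−κ_0 d_M(Y, mod Ω^c)} ≤ 𝒪(1)|Y′ ∩ Ω|_M"*, L7007–7009). This is the
printed *"further analysis"* (L7076–7077) in the Kotecký–Preiss form [KP86] (1).
[cite: Dimock2013BalabanII, App. F Theorem cluster3, proof (arXiv:1212.5562v2 TeX L7003–7014, L7046–7049, L7073–7077)] -/
theorem kp_sum_leY (Θ : Finset (TPt d N)) {Pol : Finset (Finset (TPt d N))}
    (hPol : ∀ X ∈ Pol, X.Nonempty ∧ TFaceConnected X ∧ DMod Θ X ∧ (X \ Θ).Nonempty)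
    {w : Finset (TPt d N) → ℂ} {κ κ₀ H₀ : ℝ} (hκv : 4 * 2 ^ d ≤ κ₀) (hH₀ : 0 ≤ H₀)
    (hw : ∀ Y ∈ cunions Θ Pol,
      ‖w Y‖ ≤ 2 * Real.exp 1 * K₁ d * κ₀ * H₀ * Real.exp (-(κ - κ₀ - 2) * torusTreeLenMod Y Θ))
    (hθ : theta d κ κ₀ H₀ ≤ 1) {Y : Finset (TPt d N)} (hY : Y ∈ cunions Θ Pol) :
    ∑ Y' ∈ cunions Θ Pol with IncΩ Θ Y' Y,
        ‖w Y'‖ * Real.exp (kpSizeΩ (theta d κ κ₀ H₀) Θ Y' + kpDecayΩ (delta d κ κ₀) Θ Y') ≤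
      kpSizeΩ (theta d κ κ₀ H₀) Θ Y := by
  classical
  have hκ₀ : 0 ≤ κ₀ := le_trans (by positivity) hκv
  set θ := theta d κ κ₀ H₀ with hθdef
  set δ := delta d κ κ₀ with hδdef
  set L := cunions Θ Pol with hL
  have hK₁ := K₁_pos d
  have hYΩ : (Y \ Θ).Nonempty := (geom_of_mem_cunions Θ hPol hY).2.2.2.1
  set B : ℝ := 2 * Real.exp 1 * K₁ d * κ₀ * H₀ * Real.exp (4 * 2 ^ d + δ) with hB
  have hB0 : 0 ≤ B := by positivity
  -- termwise bound
  have hterm : ∀ Y' ∈ L.filter (fun Y' => IncΩ Θ Y' Y),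
      ‖w Y'‖ * Real.exp (kpSizeΩ θ Θ Y' + kpDecayΩ δ Θ Y') ≤
        B * Real.exp (-(kappa₁ d) * torusTreeLenMod Y' Θ) := by
    intro Y' hY'
    obtain ⟨hY'L, -⟩ := Finset.mem_filter.1 hY'
    set ℓ := torusTreeLenMod Y' Θ with hℓ
    have hℓ0 : 0 ≤ ℓ := torusTreeLenMod_nonneg _ _
    have hK := hw Y' hY'L
    -- (keykey2): θ|Y' ∩ Ω| ≤ |Y' ∩ Ω| ≤ 4·2^d (1 + ℓ)
    have hsize : kpSizeΩ θ Θ Y' ≤ 4 * 2 ^ d * (1 + ℓ) := by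
      have h1 : kpSizeΩ θ Θ Y' ≤ ((Y' \ Θ).card : ℝ) := by
        unfold kpSizeΩ
        exact mul_le_of_le_one_left (Nat.cast_nonneg _) hθ
      have h2 := ResummationOperation.card_sdiff_le_torusTreeLenMod (geom_of_mem_cunions Θ hPol hY'L).2.2.2.2
      have h3 : (0 : ℝ) ≤ 2 ^ d := by positivity
      nlinarith
    have hexp : Real.exp (kpSizeΩ θ Θ Y' + kpDecayΩ δ Θ Y') ≤ Real.exp (4 * 2 ^ d * (1 + ℓ) + δ * (ℓ + 1)) := by
      rw [Real.exp_le_exp]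
      unfold kpDecayΩ
      linarith
    have hcomb : Real.exp (-(κ - κ₀ - 2) * ℓ) * Real.exp (4 * 2 ^ d * (1 + ℓ) + δ * (ℓ + 1)) =
        Real.exp (4 * 2 ^ d + δ) * Real.exp (-(kappa₁ d) * ℓ) := by
      rw [← Real.exp_add, ← Real.exp_add]
      congr 1
      simp only [hδdef, delta]
      ring
    calc ‖w Y'‖ * Real.exp (kpSizeΩ θ Θ Y' + kpDecayΩ δ Θ Y')
        ≤ (2 * Real.exp 1 * K₁ d * κ₀ * H₀ * Real.exp (-(κ - κ₀ - 2) * ℓ)) *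
            Real.exp (4 * 2 ^ d * (1 + ℓ) + δ * (ℓ + 1)) :=
          mul_le_mul hK hexp (Real.exp_pos _).le (by positivity)
      _ = B * Real.exp (-(kappa₁ d) * ℓ) := by
          rw [hB, mul_assoc (2 * Real.exp 1 * K₁ d * κ₀ * H₀), hcomb, ← mul_assoc]
  -- the sum over Y' meeting Y in Ω: (keykey1)
  have hcover : ∑ Y' ∈ L.filter (fun Y' => IncΩ Θ Y' Y), Real.exp (-(kappa₁ d) * torusTreeLenMod Y' Θ) ≤
      K₁ d * ((Y \ Θ).card : ℝ) := by
    have hsub : L.filter (fun Y' => IncΩ Θ Y' Y) ⊆ L.filter (fun Y' => ((Y' ∩ Y) \ Θ).Nonempty) := by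
      intro Y' hY'
      obtain ⟨hY'L, hI⟩ := Finset.mem_filter.1 hY'
      exact Finset.mem_filter.2 ⟨hY'L, inter_sdiff_nonempty_of_incΩ hYΩ hI⟩
    refine (Finset.sum_le_sum_of_subset_of_nonneg hsub fun _ _ _ => (Real.exp_pos _).le).trans ?_
    exact lemma_keykey1 Θ Y L (fun Y' hY' => let h := geom_of_mem_cunions Θ hPol hY'; ⟨h.1, h.2.1, h.2.2.1⟩) le_rfl
  calc ∑ Y' ∈ L.filter (fun Y' => IncΩ Θ Y' Y), ‖w Y'‖ * Real.exp (kpSizeΩ θ Θ Y' + kpDecayΩ δ Θ Y')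
      ≤ ∑ Y' ∈ L.filter (fun Y' => IncΩ Θ Y' Y), B * Real.exp (-(kappa₁ d) * torusTreeLenMod Y' Θ) :=
        Finset.sum_le_sum hterm
    _ = B * ∑ Y' ∈ L.filter (fun Y' => IncΩ Θ Y' Y), Real.exp (-(kappa₁ d) * torusTreeLenMod Y' Θ) := by
        rw [Finset.mul_sum]
    _ ≤ B * (K₁ d * ((Y \ Θ).card : ℝ)) := mul_le_mul_of_nonneg_left hcover hB0
    _ = kpSizeΩ θ Θ Y := by
        rw [hθdef, theta, kpSizeΩ, hB]
        ring

/-- **THE GAS OF Ω-CONNECTED UNIONS IS A KOTECKÝ–PREISS VOLUME** (`LatticeModels.IsKPVolume` for `IncΩ`, size `θ|Y ∩ Ω|`),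
from `kp_sum_leY` by dropping the decay (`δ ≥ 0`). [cite: Dimock2013BalabanII, App. F Theorem cluster3, proof (arXiv:1212.5562v2 TeX L7063–7077)] -/
theorem isKPVolumeY (Θ : Finset (TPt d N)) {Pol : Finset (Finset (TPt d N))}
    (hPol : ∀ X ∈ Pol, X.Nonempty ∧ TFaceConnected X ∧ DMod Θ X ∧ (X \ Θ).Nonempty)
    {w : Finset (TPt d N) → ℂ} {κ κ₀ H₀ : ℝ} (hκv : 4 * 2 ^ d ≤ κ₀)
    (hδ : 0 ≤ delta d κ κ₀) (hH₀ : 0 ≤ H₀)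
    (hw : ∀ Y ∈ cunions Θ Pol,
      ‖w Y‖ ≤ 2 * Real.exp 1 * K₁ d * κ₀ * H₀ * Real.exp (-(κ - κ₀ - 2) * torusTreeLenMod Y Θ))
    (hθ : theta d κ κ₀ H₀ ≤ 1) :
    IsKPVolume (IncΩ Θ) w (kpSizeΩ (theta d κ κ₀ H₀) Θ) (cunions Θ Pol) := by
  intro Y hY
  refine le_trans (Finset.sum_le_sum fun Y' _ => ?_) (kp_sum_leY Θ hPol hκv hH₀ hw hθ hY)
  unfold kpTerm
  refine mul_le_mul_of_nonneg_left (Real.exp_le_exp.2 (le_add_of_nonneg_right ?_)) (norm_nonneg _)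
  unfold kpDecayΩ
  have := torusTreeLenMod_nonneg Y' Θ
  positivity

/-- **THE KOTECKÝ–PREISS ESTIMATE (4) FOR THE GAS OF Ω-CONNECTED UNIONS** (tree-PROVED `LatticeModels.touchSum_le_of_kp`):
`Σ_{𝒞 ⊆ cunions, 𝒞 ι Y} ‖Φ^T(𝒞)‖·e^{d(𝒞)} ≤ θ|Y ∩ Ω|`, `d(𝒞) = Σ_{Y′∈𝒞} δ(d_M(Y′, mod Θ) + 1)`.
[cite: Dimock2013BalabanII, App. F Theorem cluster3, proof (arXiv:1212.5562v2 TeX L7063–7077)] -/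
theorem touchSum_leY (Θ : Finset (TPt d N)) {Pol : Finset (Finset (TPt d N))}
    (hPol : ∀ X ∈ Pol, X.Nonempty ∧ TFaceConnected X ∧ DMod Θ X ∧ (X \ Θ).Nonempty)
    {w : Finset (TPt d N) → ℂ} {κ κ₀ H₀ : ℝ} (hκv : 4 * 2 ^ d ≤ κ₀)
    (hδ : 0 ≤ delta d κ κ₀) (hH₀ : 0 ≤ H₀)
    (hw : ∀ Y ∈ cunions Θ Pol,
      ‖w Y‖ ≤ 2 * Real.exp 1 * K₁ d * κ₀ * H₀ * Real.exp (-(κ - κ₀ - 2) * torusTreeLenMod Y Θ))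
    (hθ : theta d κ κ₀ H₀ ≤ 1) {Y : Finset (TPt d N)} (hY : Y ∈ cunions Θ Pol) :
    touchSum (IncΩ Θ) w (kpDecayΩ (delta d κ κ₀) Θ) (cunions Θ Pol) Y ≤ kpSizeΩ (theta d κ κ₀ H₀) Θ Y := by
  have hκ₀ : 0 ≤ κ₀ := le_trans (by positivity) hκv
  have hK₁ := K₁_pos d
  refine touchSum_le_of_kp (fun Y' => ?_) (fun Y' => ?_)
    (fun Y' hY' => kp_sum_leY Θ hPol hκv hH₀ hw hθ hY') hY
  · unfold kpSizeΩ theta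
    positivity
  · unfold kpDecayΩ
    have := torusTreeLenMod_nonneg Y' Θ
    positivity

/-- **`‖H^#(Y)‖ ≤ θ|Y ∩ Ω|·e^{−δ(d_M(Y, mod Θ) + 1)}` FOR AN ACTIVITY WITH THE PRINTED (simplon) BOUND**: off clusters
`Φ^T(𝒞) = 0` (L7073; tree `truncatedWeight_eq_zero_of_kp`), on clusters (otter) gives `d(𝒞) ≥ δ(d_M(Y, mod Θ) + 1)`,
every family with union `Y` touches `Y` in `Ω`, and `touchSum_leY` bounds the weighted sum.
[cite: Dimock2013BalabanII, App. F Theorem cluster3 eq. (sunshine) (arXiv:1212.5562v2 TeX L6994–6996, L7063–7077)] -/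
theorem norm_HsharpL_leY (Θ : Finset (TPt d N)) {Pol : Finset (Finset (TPt d N))}
    (hPol : ∀ X ∈ Pol, X.Nonempty ∧ TFaceConnected X ∧ DMod Θ X ∧ (X \ Θ).Nonempty)
    {w : Finset (TPt d N) → ℂ} {κ κ₀ H₀ : ℝ} (hκv : 4 * 2 ^ d ≤ κ₀)
    (hδ : 0 ≤ delta d κ κ₀) (hH₀ : 0 ≤ H₀)
    (hw : ∀ Y ∈ cunions Θ Pol,
      ‖w Y‖ ≤ 2 * Real.exp 1 * K₁ d * κ₀ * H₀ * Real.exp (-(κ - κ₀ - 2) * torusTreeLenMod Y Θ))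
    (hθ : theta d κ κ₀ H₀ ≤ 1) {Y : Finset (TPt d N)} (hY : Y ∈ cunions Θ Pol) :
    ‖HsharpL Θ (cunions Θ Pol) w Y‖ ≤
      kpSizeΩ (theta d κ κ₀ H₀) Θ Y * Real.exp (-(kpDecayΩ (delta d κ κ₀) Θ Y)) := by
  classical
  set θ := theta d κ κ₀ H₀ with hθdef
  set δ := delta d κ κ₀ with hδdef
  set L := cunions Θ Pol with hL
  have hYΩ : (Y \ Θ).Nonempty := (geom_of_mem_cunions Θ hPol hY).2.2.2.1
  have hKP : IsKPVolume (IncΩ Θ) w (kpSizeΩ θ Θ) L := isKPVolumeY Θ hPol hκv hδ hH₀ hw hθ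
  have htouch : touchSum (IncΩ Θ) w (kpDecayΩ δ Θ) L Y ≤ kpSizeΩ θ Θ Y :=
    touchSum_leY Θ hPol hκv hδ hH₀ hw hθ hY
  have hterm : ∀ 𝒞 ∈ L.powerset.filter (fun 𝒞 => 𝒞.biUnion id = Y),
      ‖truncatedWeight (IncΩ Θ) w 𝒞‖ ≤
        Real.exp (-(kpDecayΩ δ Θ Y)) *
          (‖truncatedWeight (IncΩ Θ) w 𝒞‖ * Real.exp (∑ Y' ∈ 𝒞, kpDecayΩ δ Θ Y')) := by
    intro 𝒞 h𝒞
    obtain ⟨h𝒞L, hU⟩ := Finset.mem_filter.1 h𝒞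
    rw [Finset.mem_powerset] at h𝒞L
    by_cases hcl : IsPolymerCluster (IncΩ Θ) 𝒞
    · have h𝒞ne : 𝒞.Nonempty := by
        rw [Finset.nonempty_iff_ne_empty]
        rintro rfl
        rw [Finset.biUnion_empty] at hU
        exact (hYΩ.mono Finset.sdiff_subset).ne_empty hU.symm
      have hdec : kpDecayΩ δ Θ Y ≤ ∑ Y' ∈ 𝒞, kpDecayΩ δ Θ Y' := by
        have h := kpDecayΩ_biUnion_le_sum Θ hPol h𝒞ne h𝒞L hcl hδ
        rw [hU] at h
        exact h
      have hone : 1 ≤ Real.exp (-(kpDecayΩ δ Θ Y)) * Real.exp (∑ Y' ∈ 𝒞, kpDecayΩ δ Θ Y') := by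
        rw [← Real.exp_add]
        exact Real.one_le_exp (by linarith)
      calc ‖truncatedWeight (IncΩ Θ) w 𝒞‖ = ‖truncatedWeight (IncΩ Θ) w 𝒞‖ * 1 := (mul_one _).symm
        _ ≤ ‖truncatedWeight (IncΩ Θ) w 𝒞‖ *
              (Real.exp (-(kpDecayΩ δ Θ Y)) * Real.exp (∑ Y' ∈ 𝒞, kpDecayΩ δ Θ Y')) :=
            mul_le_mul_of_nonneg_left hone (norm_nonneg _)
        _ = _ := by ring
    · rw [truncatedWeight_eq_zero_of_kp hKP h𝒞L hcl, norm_zero, zero_mul, mul_zero]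
  have hsub : L.powerset.filter (fun 𝒞 => 𝒞.biUnion id = Y) ⊆
      L.powerset.filter (fun 𝒞 => KPTouches (IncΩ Θ) 𝒞 Y) := by
    intro 𝒞 h𝒞
    obtain ⟨h𝒞L, hU⟩ := Finset.mem_filter.1 h𝒞
    refine Finset.mem_filter.2 ⟨h𝒞L, ?_⟩
    obtain ⟨c, hc⟩ := hYΩ
    have hcY : c ∈ Y := (Finset.mem_sdiff.1 hc).1
    rw [← hU] at hcY
    obtain ⟨Y', hY'𝒞, hcY'⟩ := Finset.mem_biUnion.1 hcY
    refine ⟨Y', hY'𝒞, Or.inl ?_⟩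
    rw [Finset.not_disjoint_iff]
    exact ⟨c, Finset.mem_sdiff.2 ⟨hcY', (Finset.mem_sdiff.1 hc).2⟩, hc⟩
  calc ‖HsharpL Θ L w Y‖
      ≤ ∑ 𝒞 ∈ L.powerset.filter (fun 𝒞 => 𝒞.biUnion id = Y), ‖truncatedWeight (IncΩ Θ) w 𝒞‖ := norm_sum_le _ _
    _ ≤ ∑ 𝒞 ∈ L.powerset.filter (fun 𝒞 => 𝒞.biUnion id = Y),
          Real.exp (-(kpDecayΩ δ Θ Y)) *
            (‖truncatedWeight (IncΩ Θ) w 𝒞‖ * Real.exp (∑ Y' ∈ 𝒞, kpDecayΩ δ Θ Y')) :=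
        Finset.sum_le_sum hterm
    _ = Real.exp (-(kpDecayΩ δ Θ Y)) * ∑ 𝒞 ∈ L.powerset.filter (fun 𝒞 => 𝒞.biUnion id = Y),
          ‖truncatedWeight (IncΩ Θ) w 𝒞‖ * Real.exp (∑ Y' ∈ 𝒞, kpDecayΩ δ Θ Y') := by rw [Finset.mul_sum]
    _ ≤ Real.exp (-(kpDecayΩ δ Θ Y)) * touchSum (IncΩ Θ) w (kpDecayΩ δ Θ) L Y := by
        refine mul_le_mul_of_nonneg_left ?_ (Real.exp_pos _).le
        unfold touchSum
        exact Finset.sum_le_sum_of_subset_of_nonneg hsub fun _ _ _ =>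
          mul_nonneg (norm_nonneg _) (Real.exp_nonneg _)
    _ ≤ Real.exp (-(kpDecayΩ δ Θ Y)) * kpSizeΩ θ Θ Y := mul_le_mul_of_nonneg_left htouch (Real.exp_pos _).le
    _ = kpSizeΩ θ Θ Y * Real.exp (-(kpDecayΩ δ Θ Y)) := mul_comm _ _

/-- **(sunshine) WITH THE PRINTED DECAY LENGTH, FOR AN ACTIVITY WITH THE PRINTED (simplon) BOUND** — [Dimock2013BalabanII]
App. F, verbatim (L6994–6996): *"|H^#(Y,Φ′)| ≤ 𝒪(1) H_0 e^{−(κ − 3κ_0 − 3) d_M(Y, mod Ω^c)}"* — PROVED: `‖H^#(Y)‖ ≤ C♯(d,κ₀)·H₀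
·e^{−(κ − 3κ₀ − 3)·d_M(Y, mod Θ)}` for every Ω-connected union `Y`, under `max(κ₁(d), 4·2^d) ≤ κ₀`, `3κ₀ + 3 ≤ κ`, `0 ≤
H₀`, `2e·K₁(d)²·κ₀·e^{κ}·H₀ ≤ 1` (`C♯ = 8e·2^d·K₁(d)²·κ₀·e^{4·2^d}` as in the sibling; `c_0 = H₀`).
[cite: Dimock2013BalabanII, App. F Theorem cluster3 eq. (sunshine) (arXiv:1212.5562v2 TeX L6984–6997)] -/
theorem sunshineY_of_norm_le (Θ : Finset (TPt d N)) {Pol : Finset (Finset (TPt d N))}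
    (hPol : ∀ X ∈ Pol, X.Nonempty ∧ TFaceConnected X ∧ DMod Θ X ∧ (X \ Θ).Nonempty)
    {w : Finset (TPt d N) → ℂ} {κ κ₀ H₀ : ℝ} (hκ₁ : kappa₁ d ≤ κ₀) (hκv : 4 * 2 ^ d ≤ κ₀)
    (hκ : 3 * κ₀ + 3 ≤ κ) (hH₀ : 0 ≤ H₀)
    (hw : ∀ Y ∈ cunions Θ Pol,
      ‖w Y‖ ≤ 2 * Real.exp 1 * K₁ d * κ₀ * H₀ * Real.exp (-(κ - κ₀ - 2) * torusTreeLenMod Y Θ))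
    (hsmall : 2 * Real.exp 1 * K₁ d ^ 2 * κ₀ * Real.exp κ * H₀ ≤ 1)
    {Y : Finset (TPt d N)} (hY : Y ∈ cunions Θ Pol) :
    ‖HsharpL Θ (cunions Θ Pol) w Y‖ ≤ Csharp d κ₀ * H₀ * Real.exp (-(κ - 3 * κ₀ - 3) * torusTreeLenMod Y Θ) := by
  have hκ₀ : 0 ≤ κ₀ := le_trans (by positivity) hκv
  have hK₁ := K₁_pos d
  have hδ1 : κ - 3 * κ₀ - 3 ≤ delta d κ κ₀ - 1 := by
    simp only [delta]
    linarith
  have hδ : 0 ≤ delta d κ κ₀ := by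
    have : (0 : ℝ) ≤ 4 * 2 ^ d := by positivity
    have := kappa₁_nonneg d
    linarith
  obtain ⟨-, hθ⟩ := smallness_of_single (d := d) hκ₀ hH₀ hsmall
  have h := norm_HsharpL_leY Θ hPol hκv hδ hH₀ hw hθ hY
  refine h.trans ?_
  set ℓ := torusTreeLenMod Y Θ with hℓ
  set δ := delta d κ κ₀ with hδdef
  have hℓ0 : 0 ≤ ℓ := torusTreeLenMod_nonneg _ _
  have hcard : ((Y \ Θ).card : ℝ) ≤ 4 * 2 ^ d * Real.exp ℓ := by
    have h1 := ResummationOperation.card_sdiff_le_torusTreeLenMod (geom_of_mem_cunions Θ hPol hY).2.2.2.2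
    have := Real.add_one_le_exp ℓ
    have h2 : (0 : ℝ) ≤ 2 ^ d := by positivity
    nlinarith
  have hθexp : theta d κ κ₀ H₀ * Real.exp (-(kpDecayΩ δ Θ Y)) =
      2 * Real.exp 1 * K₁ d ^ 2 * κ₀ * Real.exp (4 * 2 ^ d) * H₀ * Real.exp (-δ * ℓ) := by
    unfold theta kpDecayΩ
    rw [show 2 * Real.exp 1 * K₁ d ^ 2 * κ₀ * Real.exp (4 * 2 ^ d + δ) * H₀ * Real.exp (-(δ * (ℓ + 1))) =
      2 * Real.exp 1 * K₁ d ^ 2 * κ₀ * H₀ * (Real.exp (4 * 2 ^ d + δ) * Real.exp (-(δ * (ℓ + 1)))) by ring,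
      ← Real.exp_add,
      show 2 * Real.exp 1 * K₁ d ^ 2 * κ₀ * Real.exp (4 * 2 ^ d) * H₀ * Real.exp (-δ * ℓ) =
      2 * Real.exp 1 * K₁ d ^ 2 * κ₀ * H₀ * (Real.exp (4 * 2 ^ d) * Real.exp (-δ * ℓ)) by ring,
      ← Real.exp_add]
    congr 2
    ring
  have hrate : Real.exp ℓ * Real.exp (-δ * ℓ) ≤ Real.exp (-(κ - 3 * κ₀ - 3) * ℓ) := by
    rw [← Real.exp_add, Real.exp_le_exp]
    nlinarith
  have hA : 0 ≤ 2 * Real.exp 1 * K₁ d ^ 2 * κ₀ * Real.exp (4 * 2 ^ d) * H₀ := by positivity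
  calc kpSizeΩ (theta d κ κ₀ H₀) Θ Y * Real.exp (-(kpDecayΩ δ Θ Y))
      = ((Y \ Θ).card : ℝ) * (theta d κ κ₀ H₀ * Real.exp (-(kpDecayΩ δ Θ Y))) := by unfold kpSizeΩ; ring
    _ = ((Y \ Θ).card : ℝ) * (2 * Real.exp 1 * K₁ d ^ 2 * κ₀ * Real.exp (4 * 2 ^ d) * H₀ * Real.exp (-δ * ℓ)) := by
        rw [hθexp]
    _ ≤ (4 * 2 ^ d * Real.exp ℓ) *
          (2 * Real.exp 1 * K₁ d ^ 2 * κ₀ * Real.exp (4 * 2 ^ d) * H₀ * Real.exp (-δ * ℓ)) :=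
        mul_le_mul_of_nonneg_right hcard (mul_nonneg hA (Real.exp_pos _).le)
    _ = Csharp d κ₀ * H₀ * (Real.exp ℓ * Real.exp (-δ * ℓ)) := by unfold Csharp; ring
    _ ≤ Csharp d κ₀ * H₀ * Real.exp (-(κ - 3 * κ₀ - 3) * ℓ) :=
        mul_le_mul_of_nonneg_left hrate (by unfold Csharp; positivity)

end Torus

/-! ## Part 4. THEOREM F.1 in the printed indexing, at a fixed field: (gog2) and (sunshine) -/

section TheoremF1

variable {d N : ℕ} [NeZero N]

/-- (simplon) `norm_KY_le` as the activity hypothesis of Part 3: Dimock's `K` on the Ω-connected unions obeys `‖K(Y)‖ ≤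
2eK₁(d)κ₀H₀e^{−(κ−κ₀−2)·d_M(Y, mod Θ)}`. [cite: Dimock2013BalabanII, App. F Theorem cluster3, proof eq. (simplon) (arXiv:1212.5562v2 TeX L7046–7049)] -/
theorem norm_KY_le_of_mem_cunions (Θ : Finset (TPt d N)) {Pol : Finset (Finset (TPt d N))}
    (hPol : ∀ X ∈ Pol, X.Nonempty ∧ TFaceConnected X ∧ DMod Θ X ∧ (X \ Θ).Nonempty)
    {a : Finset (TPt d N) → ℂ} {κ κ₀ H₀ : ℝ} (hκ₁ : kappa₁ d ≤ κ₀) (hκv : 4 * 2 ^ d ≤ κ₀) (hκ : κ₀ ≤ κ)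
    (hH₀ : 0 ≤ H₀) (ha : ∀ X ∈ Pol, ‖a X‖ ≤ 2 * H₀ * Real.exp (-κ * torusTreeLenMod X Θ))
    (hsmall₁ : 2 * H₀ * K₁ d * κ₀ * Real.exp (κ - κ₀) ≤ 1) :
    ∀ Y ∈ cunions Θ Pol, ‖KY id Θ Pol (fun T => ∏ X ∈ T, a X) Y‖ ≤
      2 * Real.exp 1 * K₁ d * κ₀ * H₀ * Real.exp (-(κ - κ₀ - 2) * torusTreeLenMod Y Θ) :=
  fun Y _ => norm_KY_le Θ hPol hκ₁ hκv hκ hH₀ ha hsmall₁ Y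

omit [NeZero N] in
/-- **STEPS 1 + 3 in the printed indexing**: `exp(Σ_{X∈Pol} H(X)) = Ξ_{cunions}(K)` — the Mayer expansion over the
families with disjoint Ω-parts (`cexp_sum_eq_mayerY`) is the hard-core partition function of the gas of unions
(`sum_famDY_prod_eq_polymerPartitionFunction`), and the unions without an Ω-connected cover drop out (`K = 0` there).
[cite: Dimock2013BalabanII, App. F Theorem cluster3, proof (arXiv:1212.5562v2 TeX L7025–7039, L7063–7067)] -/
theorem cexp_sum_eq_polymerPartitionFunction_cunions (Θ : Finset (TPt d N)) {Pol : Finset (Finset (TPt d N))}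
    (hΩ : ∀ X ∈ Pol, (X \ Θ).Nonempty) (H : Finset (TPt d N) → ℂ) :
    Complex.exp (∑ X ∈ Pol, H X) =
      polymerPartitionFunction (IncΩ Θ) (KY id Θ Pol fun T => ∏ X ∈ T, (Complex.exp (H X) - 1))
        (cunions Θ Pol) := by
  classical
  rw [cexp_sum_eq_mayerY (idx := id) (Θ := Θ) hΩ H, sum_famDY_prod_eq_polymerPartitionFunction]
  exact polymerPartitionFunction_eq_of_zero_off (IncΩ Θ) (cunions_subset Θ Pol)
    fun Y hY hY' => KY_eq_zero_of_not_mem _ hY hY'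

/-- **THEOREM F.1 (gog2) IN THE PRINTED INDEXING, at a fixed field** — [Dimock2013BalabanII] App. F, verbatim (L6989–6992,
L6994–6996): *"Then  Ξ = exp( Σ_Y H^#(Y,Φ′) )  (gog2)  where the sum is over Y ∈ 𝒟_k(mod Ω^c) such that Y ∩ Λ ≠ ∅"* —
PROVED on the torus polymer model with holes, `H^#` INDEXED BY THE UNIONS `Y` (decay length `d_M(Y, mod Ω^c)`, Part 3):
for polymers with holes `Pol`, `‖H(X)‖ ≤ H₀e^{−κ d_M(X, mod Θ)}` on `Pol`, `0 ≤ H₀ ≤ log 2`, `max(κ₁(d), 4·2^d) ≤ κ₀`, `3κ₀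
+ 3 ≤ κ`, `2e·K₁(d)²·κ₀·e^{κ}·H₀ ≤ 1`: `exp(Σ_{X∈Pol} H(X)) = exp(Σ_Y H^#(Y))` with `H^#(Y) = HsharpL Θ (cunions Θ Pol) K Y`
and `K(Y) = Σ_{{X_i} Ω-connected: ∪X_i = Y} Π_i(e^{H(X_i)} − 1)`. [cite: Dimock2013BalabanII, App. F Theorem cluster3 eq. (gog2) (arXiv:1212.5562v2 TeX L6973–6997)] -/
theorem gog2Y (Θ : Finset (TPt d N)) {Pol : Finset (Finset (TPt d N))}
    (hPol : ∀ X ∈ Pol, X.Nonempty ∧ TFaceConnected X ∧ DMod Θ X ∧ (X \ Θ).Nonempty)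
    {H : Finset (TPt d N) → ℂ} {κ κ₀ H₀ : ℝ} (hκ₁ : kappa₁ d ≤ κ₀) (hκv : 4 * 2 ^ d ≤ κ₀)
    (hκ : 3 * κ₀ + 3 ≤ κ) (hH₀ : 0 ≤ H₀) (hlog : H₀ ≤ Real.log 2)
    (hH : ∀ X ∈ Pol, ‖H X‖ ≤ H₀ * Real.exp (-κ * torusTreeLenMod X Θ))
    (hsmall : 2 * Real.exp 1 * K₁ d ^ 2 * κ₀ * Real.exp κ * H₀ ≤ 1) :
    Complex.exp (∑ X ∈ Pol, H X) =
      Complex.exp (∑ Y ∈ (cunions Θ Pol).powerset.image (fun 𝒞 => 𝒞.biUnion id),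
        HsharpL Θ (cunions Θ Pol) (KY id Θ Pol fun T => ∏ X ∈ T, (Complex.exp (H X) - 1)) Y) := by
  have hκ₀ : 0 ≤ κ₀ := le_trans (by positivity) hκv
  have hκ0 : 0 ≤ κ := by linarith
  have hκ' : κ₀ ≤ κ := by linarith
  have hδ : 0 ≤ delta d κ κ₀ := by
    have : (0 : ℝ) ≤ 4 * 2 ^ d := by positivity
    have := kappa₁_nonneg d
    simp only [delta]
    linarith
  obtain ⟨hsmall₁, hθ⟩ := smallness_of_single (d := d) hκ₀ hH₀ hsmall
  have ha := weight_le_of_mem Θ hH₀ hlog hκ0 hH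
  rw [cexp_sum_eq_polymerPartitionFunction_cunions Θ (fun X hX => (hPol X hX).2.2.2) H]
  exact polymerPartitionFunction_eq_cexp_sum_HsharpL
    (isKPVolumeY Θ hPol hκv hδ hH₀ (norm_KY_le_of_mem_cunions Θ hPol hκ₁ hκv hκ' hH₀ ha hsmall₁) hθ)

/-- **THEOREM F.1 (sunshine) IN THE PRINTED INDEXING, at a fixed field**: `‖H^#(Y)‖ ≤ C♯(d,κ₀)·H₀·e^{−(κ − 3κ₀ −
3)·d_M(Y, mod Θ)}` for every Ω-connected union `Y`, for activities `‖a(X)‖ ≤ 2H₀e^{−κ d_M(X, mod Θ)}` on `Pol` (Part 3's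
`sunshineY_of_norm_le` with (simplon) `norm_KY_le`). [cite: Dimock2013BalabanII, App. F Theorem cluster3 eq. (sunshine) (arXiv:1212.5562v2 TeX L6984–6997)] -/
theorem sunshineY (Θ : Finset (TPt d N)) {Pol : Finset (Finset (TPt d N))}
    (hPol : ∀ X ∈ Pol, X.Nonempty ∧ TFaceConnected X ∧ DMod Θ X ∧ (X \ Θ).Nonempty)
    {a : Finset (TPt d N) → ℂ} {κ κ₀ H₀ : ℝ} (hκ₁ : kappa₁ d ≤ κ₀) (hκv : 4 * 2 ^ d ≤ κ₀)
    (hκ : 3 * κ₀ + 3 ≤ κ) (hH₀ : 0 ≤ H₀)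
    (ha : ∀ X ∈ Pol, ‖a X‖ ≤ 2 * H₀ * Real.exp (-κ * torusTreeLenMod X Θ))
    (hsmall : 2 * Real.exp 1 * K₁ d ^ 2 * κ₀ * Real.exp κ * H₀ ≤ 1)
    {Y : Finset (TPt d N)} (hY : Y ∈ cunions Θ Pol) :
    ‖HsharpL Θ (cunions Θ Pol) (KY id Θ Pol fun T => ∏ X ∈ T, a X) Y‖ ≤
      Csharp d κ₀ * H₀ * Real.exp (-(κ - 3 * κ₀ - 3) * torusTreeLenMod Y Θ) := by
  have hκ₀ : 0 ≤ κ₀ := le_trans (by positivity) hκv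
  have hκ' : κ₀ ≤ κ := by linarith
  obtain ⟨hsmall₁, -⟩ := smallness_of_single (d := d) hκ₀ hH₀ hsmall
  exact sunshineY_of_norm_le Θ hPol hκ₁ hκv hκ hH₀
    (norm_KY_le_of_mem_cunions Θ hPol hκ₁ hκv hκ' hH₀ ha hsmall₁) hsmall hY

/-- (sunshine) for the activities `e^{H(X)} − 1` of (gog2), in the printed indexing. [cite: Dimock2013BalabanII, App. F Theorem cluster3 (arXiv:1212.5562v2 TeX L6984–6997)] -/
theorem sunshineY_of_H (Θ : Finset (TPt d N)) {Pol : Finset (Finset (TPt d N))}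
    (hPol : ∀ X ∈ Pol, X.Nonempty ∧ TFaceConnected X ∧ DMod Θ X ∧ (X \ Θ).Nonempty)
    {H : Finset (TPt d N) → ℂ} {κ κ₀ H₀ : ℝ} (hκ₁ : kappa₁ d ≤ κ₀) (hκv : 4 * 2 ^ d ≤ κ₀)
    (hκ : 3 * κ₀ + 3 ≤ κ) (hH₀ : 0 ≤ H₀) (hlog : H₀ ≤ Real.log 2)
    (hH : ∀ X ∈ Pol, ‖H X‖ ≤ H₀ * Real.exp (-κ * torusTreeLenMod X Θ))
    (hsmall : 2 * Real.exp 1 * K₁ d ^ 2 * κ₀ * Real.exp κ * H₀ ≤ 1)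
    {Y : Finset (TPt d N)} (hY : Y ∈ cunions Θ Pol) :
    ‖HsharpL Θ (cunions Θ Pol) (KY id Θ Pol fun T => ∏ X ∈ T, (Complex.exp (H X) - 1)) Y‖ ≤
      Csharp d κ₀ * H₀ * Real.exp (-(κ - 3 * κ₀ - 3) * torusTreeLenMod Y Θ) := by
  have hκ₀ : 0 ≤ κ₀ := le_trans (by positivity) hκv
  have hκ0 : 0 ≤ κ := by linarith
  exact sunshineY Θ hPol hκ₁ hκv hκ hH₀ (weight_le_of_mem Θ hH₀ hlog hκ0 hH) hsmall hY

end TheoremF1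

/-! ## Part 5. THEOREM F.1 in the printed indexing WITH ITS INTEGRATION over an ultralocal measure -/

section Integrated

variable {d N : ℕ} [NeZero N] {E : Type*}

/-- Dimock's `K(Y,Φ′,Φ)` at the field `Φ` in the printed indexing (L7031–7035). [cite: Dimock2013BalabanII, App. F Theorem cluster3, proof (arXiv:1212.5562v2 TeX L7025–7035)] -/
def KYfield (Θ : Finset (TPt d N)) (Pol : Finset (Finset (TPt d N))) (H : Finset (TPt d N) → (TPt d N → E) → ℝ)
    (Y : Finset (TPt d N)) (Φ : TPt d N → E) : ℝ :=
  KY id Θ Pol (fun T => ∏ X ∈ T, (Real.exp (H X Φ) - 1)) Y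

omit [NeZero N] in
/-- **`K(Y,Φ′,Φ)` DEPENDS ON `Φ` ONLY IN `Y ∩ Λ`** (L7035 *"K(Y) = K(Y,Φ′,Φ) only depends on Φ′ in Y and Φ in Y ∩ Λ"*): if
each `H(X, ·)` depends on the field only in `X ∩ Λ` and `Λ ∩ Θ = ∅`, then `K(Y, ·)` depends on the field only in `Y ∩ Ω`.
[cite: Dimock2013BalabanII, App. F Theorem cluster3, proof (arXiv:1212.5562v2 TeX L7031–7035)] -/
theorem dependsOn_KYfield (Θ Λ : Finset (TPt d N)) (hΛ : Disjoint Λ Θ) {Pol : Finset (Finset (TPt d N))}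
    {H : Finset (TPt d N) → (TPt d N → E) → ℝ}
    (hHd : ∀ X ∈ Pol, DependsOn (H X) ((X ∩ Λ : Finset (TPt d N)) : Set (TPt d N))) (Y : Finset (TPt d N)) :
    DependsOn (KYfield Θ Pol H Y) ((Y \ Θ : Finset (TPt d N)) : Set (TPt d N)) := by
  intro Φ Ψ hΦΨ
  show (∑ T ∈ coversY id Θ Pol Y, ∏ X ∈ T, (Real.exp (H X Φ) - 1)) =
    ∑ T ∈ coversY id Θ Pol Y, ∏ X ∈ T, (Real.exp (H X Ψ) - 1)
  refine Finset.sum_congr rfl fun T hT => Finset.prod_congr rfl fun X hX => ?_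
  obtain ⟨hTP, -, hU⟩ := mem_coversY.1 hT
  have hU' : T.biUnion id = Y := hU
  have hsub : X ∩ Λ ⊆ Y \ Θ := by
    intro c hc
    rw [Finset.mem_inter] at hc
    refine Finset.mem_sdiff.2 ⟨?_, Finset.disjoint_left.1 hΛ hc.2⟩
    rw [← hU']
    exact Finset.mem_biUnion.2 ⟨X, hX, hc.1⟩
  rw [hHd X (hTP hX) (fun c hc => hΦΨ c (Finset.mem_coe.2 (hsub (Finset.mem_coe.1 hc))))]

/-- **(simplon) AT EACH FIELD, printed indexing**: `|K(Y,Φ)| ≤ 2eK₁(d)κ₀H₀e^{−(κ−κ₀−2)·d_M(Y, mod Θ)}` on the whole field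
space, by `norm_KY_le` with the real activities `e^{H(X,Φ)} − 1`. [cite: Dimock2013BalabanII, App. F Theorem cluster3, proof eq. (simplon) (arXiv:1212.5562v2 TeX L7046–7049)] -/
theorem abs_KYfield_le (Θ : Finset (TPt d N)) {Pol : Finset (Finset (TPt d N))}
    (hPol : ∀ X ∈ Pol, X.Nonempty ∧ TFaceConnected X ∧ DMod Θ X ∧ (X \ Θ).Nonempty)
    {H : Finset (TPt d N) → (TPt d N → E) → ℝ} {κ κ₀ H₀ : ℝ} (hκ₁ : kappa₁ d ≤ κ₀) (hκv : 4 * 2 ^ d ≤ κ₀)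
    (hκ : κ₀ ≤ κ) (hH₀ : 0 ≤ H₀) (hlog : H₀ ≤ Real.log 2)
    (hH : ∀ X ∈ Pol, ∀ Φ, |H X Φ| ≤ H₀ * Real.exp (-κ * torusTreeLenMod X Θ))
    (hsmall₁ : 2 * H₀ * K₁ d * κ₀ * Real.exp (κ - κ₀) ≤ 1) (Y : Finset (TPt d N)) (Φ : TPt d N → E) :
    |KYfield Θ Pol H Y Φ| ≤ 2 * Real.exp 1 * K₁ d * κ₀ * H₀ * Real.exp (-(κ - κ₀ - 2) * torusTreeLenMod Y Θ) := by
  have hκ0 : 0 ≤ κ := (le_trans (by positivity) hκv).trans hκ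
  have h := norm_KY_le (𝕜 := ℝ) Θ hPol hκ₁ hκv hκ hH₀ (abs_weight_le_of_mem Θ hH₀ hlog hκ0 hH Φ) hsmall₁ Y
  rw [Real.norm_eq_abs] at h
  exact h

variable [MeasurableSpace E]

/-- **`K^#(Y,Φ′) = ∫ K(Y,Φ′,Φ) dμ_Λ(Φ)`** (L7058–7060), printed indexing, for the ultralocal measure `μ_Λ = ⊗_c ν_c`.
[cite: Dimock2013BalabanII, App. F Theorem cluster3, proof (arXiv:1212.5562v2 TeX L7051–7061)] -/
def KYsharp (ν : TPt d N → MeasureTheory.Measure E) (Θ : Finset (TPt d N)) (Pol : Finset (Finset (TPt d N)))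
    (H : Finset (TPt d N) → (TPt d N → E) → ℝ) (Y : Finset (TPt d N)) : ℝ :=
  ∫ Φ, KYfield Θ Pol H Y Φ ∂(MeasureTheory.Measure.pi ν)

omit [NeZero N] in
/-- `K(Y, ·)` is measurable when the `H(X, ·)`, `X ∈ Pol`, are. [cite: Dimock2013BalabanII, App. F Theorem cluster3, proof (arXiv:1212.5562v2 TeX L7025–7035)] -/
theorem measurable_KYfield (Θ : Finset (TPt d N)) {Pol : Finset (Finset (TPt d N))}
    {H : Finset (TPt d N) → (TPt d N → E) → ℝ} (hHm : ∀ X ∈ Pol, Measurable (H X)) (Y : Finset (TPt d N)) :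
    Measurable (KYfield Θ Pol H Y) := by
  show Measurable fun Φ => ∑ T ∈ coversY id Θ Pol Y, ∏ X ∈ T, (Real.exp (H X Φ) - 1)
  refine Finset.measurable_sum _ fun T hT => ?_
  have hTP : T ⊆ Pol := (mem_coversY.1 hT).1
  exact Finset.measurable_prod _ fun X hX => (Real.measurable_exp.comp (hHm X (hTP hX))).sub measurable_const

variable (ν : TPt d N → MeasureTheory.Measure E) [∀ c, MeasureTheory.IsProbabilityMeasure (ν c)]

/-- **`K^#` AGAIN SATISFIES THE BOUND (simplon)** (L7061), printed indexing. [cite: Dimock2013BalabanII, App. F Theorem cluster3, proof (arXiv:1212.5562v2 TeX L7051–7061)] -/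
theorem abs_KYsharp_le (Θ : Finset (TPt d N)) {Pol : Finset (Finset (TPt d N))}
    (hPol : ∀ X ∈ Pol, X.Nonempty ∧ TFaceConnected X ∧ DMod Θ X ∧ (X \ Θ).Nonempty)
    {H : Finset (TPt d N) → (TPt d N → E) → ℝ} {κ κ₀ H₀ : ℝ} (hκ₁ : kappa₁ d ≤ κ₀) (hκv : 4 * 2 ^ d ≤ κ₀)
    (hκ : κ₀ ≤ κ) (hH₀ : 0 ≤ H₀) (hlog : H₀ ≤ Real.log 2)
    (hH : ∀ X ∈ Pol, ∀ Φ, |H X Φ| ≤ H₀ * Real.exp (-κ * torusTreeLenMod X Θ))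
    (hsmall₁ : 2 * H₀ * K₁ d * κ₀ * Real.exp (κ - κ₀) ≤ 1) (Y : Finset (TPt d N)) :
    |KYsharp ν Θ Pol H Y| ≤ 2 * Real.exp 1 * K₁ d * κ₀ * H₀ * Real.exp (-(κ - κ₀ - 2) * torusTreeLenMod Y Θ) := by
  unfold KYsharp
  exact UltralocalFactorization.abs_integral_le_of_abs_le ν fun Φ =>
    abs_KYfield_le Θ hPol hκ₁ hκv hκ hH₀ hlog hH hsmall₁ Y Φ

/-- **STEPS 1–2 in the printed indexing: `∫ exp(Σ_X H(X,Φ)) dμ_Λ(Φ) = Σ_{{Y_j}} Π_j K^#(Y_j)`** (L7025–7029 + L7051–7061): the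
Mayer expansion at each field (`exp_sum_eq_mayerY`), the finite sum taken out of the integral, and the FACTORISATION
over the families `{Y_j}` by independence — the Ω-parts `Y_j ∩ Ω` are pairwise disjoint and `K(Y_j, ·)` depends on the
field only in `Y_j ∩ Ω` (`UltralocalFactorization.integral_prod_eq_prod_integral`; *"Because the Y_j ∩ Ω are disjoint,
the Y_j ∩ Λ are disjoint. Since K(Y,Φ′Φ) depends on Φ only in Y_i ∩ Λ, and because fields at different sites are
independent random variables …"*, L7051–7053).
[cite: Dimock2013BalabanII, App. F Theorem cluster3, proof (arXiv:1212.5562v2 TeX L7025–7039, L7051–7061)] -/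
theorem integral_exp_sum_eq_sum_famDY (Θ Λ : Finset (TPt d N)) (hΛ : Disjoint Λ Θ) {Pol : Finset (Finset (TPt d N))}
    (hPol : ∀ X ∈ Pol, X.Nonempty ∧ TFaceConnected X ∧ DMod Θ X ∧ (X \ Θ).Nonempty)
    {H : Finset (TPt d N) → (TPt d N → E) → ℝ} {κ κ₀ H₀ : ℝ} (hκ₁ : kappa₁ d ≤ κ₀) (hκv : 4 * 2 ^ d ≤ κ₀)
    (hκ : κ₀ ≤ κ) (hH₀ : 0 ≤ H₀) (hlog : H₀ ≤ Real.log 2) (hHm : ∀ X ∈ Pol, Measurable (H X))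
    (hHd : ∀ X ∈ Pol, DependsOn (H X) ((X ∩ Λ : Finset (TPt d N)) : Set (TPt d N)))
    (hH : ∀ X ∈ Pol, ∀ Φ, |H X Φ| ≤ H₀ * Real.exp (-κ * torusTreeLenMod X Θ))
    (hsmall₁ : 2 * H₀ * K₁ d * κ₀ * Real.exp (κ - κ₀) ≤ 1) :
    ∫ Φ, Real.exp (∑ X ∈ Pol, H X Φ) ∂(MeasureTheory.Measure.pi ν) =
      ∑ 𝒴 ∈ famDY id Θ Pol, ∏ Y ∈ 𝒴, KYsharp ν Θ Pol H Y := by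
  classical
  have h1 : (fun Φ : TPt d N → E => Real.exp (∑ X ∈ Pol, H X Φ)) =
      fun Φ => ∑ 𝒴 ∈ famDY id Θ Pol, ∏ Y ∈ 𝒴, KYfield Θ Pol H Y Φ := by
    funext Φ
    exact exp_sum_eq_mayerY (idx := id) (Θ := Θ) (fun X hX => (hPol X hX).2.2.2) (fun X => H X Φ)
  rw [h1, MeasureTheory.integral_finsetSum _ (fun 𝒴 _ => ?_)]
  · refine Finset.sum_congr rfl fun 𝒴 h𝒴 => ?_
    exact UltralocalFactorization.integral_prod_eq_prod_integral ν 𝒴 (fun Y : Finset (TPt d N) => Y \ Θ)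
      (mem_famDY.1 h𝒴).2.1 (KYfield Θ Pol H) (fun Y _ => measurable_KYfield Θ hHm Y)
      (fun Y _ => dependsOn_KYfield Θ Λ hΛ hHd Y)
  · refine (MeasureTheory.integrable_const (∏ Y ∈ 𝒴,
        2 * Real.exp 1 * K₁ d * κ₀ * H₀ * Real.exp (-(κ - κ₀ - 2) * torusTreeLenMod Y Θ))).mono'
      (Finset.measurable_prod 𝒴 fun Y _ => measurable_KYfield Θ hHm Y).aestronglyMeasurable
      (Filter.Eventually.of_forall fun Φ => ?_)
    rw [Real.norm_eq_abs, Finset.abs_prod]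
    exact Finset.prod_le_prod (fun Y _ => abs_nonneg _) fun Y _ =>
      abs_KYfield_le Θ hPol hκ₁ hκv hκ hH₀ hlog hH hsmall₁ Y Φ

/-- **THEOREM F.1 (gog2) IN THE PRINTED INDEXING, WITH ITS INTEGRATION STEP** — [Dimock2013BalabanII] App. F, verbatim
(L6975–6992): *"Ξ = ∫ exp( Σ_{X ∈ 𝒟_k(mod Ω^c), X ∩ Λ ≠ ∅} H(X,Φ′,Φ) ) dμ_Λ(Φ) … Then  Ξ = exp( Σ_Y H^#(Y,Φ′) )"* — PROVED
on the torus polymer model with holes, `H^#` indexed by the unions `Y`: for the ultralocal `μ_Λ = ⊗_c ν_c` on fields `Φ : TPt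
d N → E`, measurable `H(X, ·)` depending on the field only in `X ∩ Λ` (`Λ ∩ Θ = ∅`), `|H(X,Φ)| ≤ H₀e^{−κ d_M(X, mod Θ)}`, `0 ≤
H₀ ≤ log 2`, `max(κ₁(d), 4·2^d) ≤ κ₀`, `3κ₀ + 3 ≤ κ`, `2e·K₁(d)²·κ₀·e^{κ}·H₀ ≤ 1`: `∫exp(Σ_{X∈Pol} H(X,Φ))dμ_Λ(Φ) = exp(Σ_Y
H^#(Y))`, `H^#` for the INTEGRATED activities `K^#(Y) = ∫K(Y,Φ)dμ_Λ`. [cite: Dimock2013BalabanII, App. F Theorem cluster3 eq. (gog2) (arXiv:1212.5562v2 TeX L6973–6992)] -/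
theorem gog2Y_integrated (Θ Λ : Finset (TPt d N)) (hΛ : Disjoint Λ Θ) {Pol : Finset (Finset (TPt d N))}
    (hPol : ∀ X ∈ Pol, X.Nonempty ∧ TFaceConnected X ∧ DMod Θ X ∧ (X \ Θ).Nonempty)
    {H : Finset (TPt d N) → (TPt d N → E) → ℝ} {κ κ₀ H₀ : ℝ} (hκ₁ : kappa₁ d ≤ κ₀) (hκv : 4 * 2 ^ d ≤ κ₀)
    (hκ : 3 * κ₀ + 3 ≤ κ) (hH₀ : 0 ≤ H₀) (hlog : H₀ ≤ Real.log 2) (hHm : ∀ X ∈ Pol, Measurable (H X))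
    (hHd : ∀ X ∈ Pol, DependsOn (H X) ((X ∩ Λ : Finset (TPt d N)) : Set (TPt d N)))
    (hH : ∀ X ∈ Pol, ∀ Φ, |H X Φ| ≤ H₀ * Real.exp (-κ * torusTreeLenMod X Θ))
    (hsmall : 2 * Real.exp 1 * K₁ d ^ 2 * κ₀ * Real.exp κ * H₀ ≤ 1) :
    ((∫ Φ, Real.exp (∑ X ∈ Pol, H X Φ) ∂(MeasureTheory.Measure.pi ν) : ℝ) : ℂ) =
      Complex.exp (∑ Y ∈ (cunions Θ Pol).powerset.image (fun 𝒞 => 𝒞.biUnion id),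
        HsharpL Θ (cunions Θ Pol) (fun Y => ((KYsharp ν Θ Pol H Y : ℝ) : ℂ)) Y) := by
  classical
  have hκ₀ : 0 ≤ κ₀ := le_trans (by positivity) hκv
  have hκ' : κ₀ ≤ κ := by linarith
  have hδ : 0 ≤ delta d κ κ₀ := by
    have : (0 : ℝ) ≤ 4 * 2 ^ d := by positivity
    have := kappa₁_nonneg d
    simp only [delta]
    linarith
  obtain ⟨hsmall₁, hθ⟩ := smallness_of_single (d := d) hκ₀ hH₀ hsmall
  have hw : ∀ Y ∈ cunions Θ Pol, ‖((KYsharp ν Θ Pol H Y : ℝ) : ℂ)‖ ≤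
      2 * Real.exp 1 * K₁ d * κ₀ * H₀ * Real.exp (-(κ - κ₀ - 2) * torusTreeLenMod Y Θ) := fun Y _ => by
    rw [Complex.norm_real, Real.norm_eq_abs]
    exact abs_KYsharp_le ν Θ hPol hκ₁ hκv hκ' hH₀ hlog hH hsmall₁ Y
  have hzero : ∀ Y ∈ unionsY id Θ Pol, Y ∉ cunions Θ Pol → ((KYsharp ν Θ Pol H Y : ℝ) : ℂ) = 0 := by
    intro Y hY hY'
    have h0 : ∀ Φ, KYfield Θ Pol H Y Φ = 0 := fun Φ =>
      KY_eq_zero_of_not_mem (fun T => ∏ X ∈ T, (Real.exp (H X Φ) - 1)) hY hY'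
    simp only [KYsharp, h0, MeasureTheory.integral_zero, Complex.ofReal_zero]
  rw [integral_exp_sum_eq_sum_famDY ν Θ Λ hΛ hPol hκ₁ hκv hκ' hH₀ hlog hHm hHd hH hsmall₁]
  push_cast
  rw [sum_famDY_prod_eq_polymerPartitionFunction (fun Y => ((KYsharp ν Θ Pol H Y : ℝ) : ℂ)),
    polymerPartitionFunction_eq_of_zero_off (IncΩ Θ) (cunions_subset Θ Pol) hzero,
    polymerPartitionFunction_eq_cexp_sum_HsharpL (isKPVolumeY Θ hPol hκv hδ hH₀ hw hθ)]

/-- **THEOREM F.1 (sunshine) IN THE PRINTED INDEXING, WITH ITS INTEGRATION STEP**: in the setting of `gog2Y_integrated`, for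
every Ω-connected union `Y`, `‖H^#(Y)‖ ≤ C♯(d,κ₀)·H₀·e^{−(κ − 3κ₀ − 3)·d_M(Y, mod Θ)}` for the `H^#` of the INTEGRATED
activities `K^#`. [cite: Dimock2013BalabanII, App. F Theorem cluster3 eq. (sunshine) (arXiv:1212.5562v2 TeX L6984–6997)] -/
theorem sunshineY_integrated (Θ : Finset (TPt d N)) {Pol : Finset (Finset (TPt d N))}
    (hPol : ∀ X ∈ Pol, X.Nonempty ∧ TFaceConnected X ∧ DMod Θ X ∧ (X \ Θ).Nonempty)
    {H : Finset (TPt d N) → (TPt d N → E) → ℝ} {κ κ₀ H₀ : ℝ} (hκ₁ : kappa₁ d ≤ κ₀) (hκv : 4 * 2 ^ d ≤ κ₀)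
    (hκ : 3 * κ₀ + 3 ≤ κ) (hH₀ : 0 ≤ H₀) (hlog : H₀ ≤ Real.log 2)
    (hH : ∀ X ∈ Pol, ∀ Φ, |H X Φ| ≤ H₀ * Real.exp (-κ * torusTreeLenMod X Θ))
    (hsmall : 2 * Real.exp 1 * K₁ d ^ 2 * κ₀ * Real.exp κ * H₀ ≤ 1)
    {Y : Finset (TPt d N)} (hY : Y ∈ cunions Θ Pol) :
    ‖HsharpL Θ (cunions Θ Pol) (fun Y => ((KYsharp ν Θ Pol H Y : ℝ) : ℂ)) Y‖ ≤
      Csharp d κ₀ * H₀ * Real.exp (-(κ - 3 * κ₀ - 3) * torusTreeLenMod Y Θ) := by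
  have hκ₀ : 0 ≤ κ₀ := le_trans (by positivity) hκv
  have hκ' : κ₀ ≤ κ := by linarith
  obtain ⟨hsmall₁, -⟩ := smallness_of_single (d := d) hκ₀ hH₀ hsmall
  have hw : ∀ Y ∈ cunions Θ Pol, ‖((KYsharp ν Θ Pol H Y : ℝ) : ℂ)‖ ≤
      2 * Real.exp 1 * K₁ d * κ₀ * H₀ * Real.exp (-(κ - κ₀ - 2) * torusTreeLenMod Y Θ) := fun Y _ => by
    rw [Complex.norm_real, Real.norm_eq_abs]
    exact abs_KYsharp_le ν Θ hPol hκ₁ hκv hκ' hH₀ hlog hH hsmall₁ Y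
  exact sunshineY_of_norm_le Θ hPol hκ₁ hκv hκ hH₀ hw hsmall hY

end Integrated

/-! ## Part 6. Part I's THEOREM `cluster` (App. B, [Dimock2013] L3178–3194) as the hole-free case `Θ = ∅` -/

section PartI

variable {d N : ℕ} [NeZero N]

omit [NeZero N] in
/-- With no holes, Dimock's part I polymers (non-empty connected unions of `M`-cubes) are polymers with holes `Θ = ∅`.
[cite: Dimock2013, App. B Theorem cluster (arXiv:1108.1335v2 TeX L3178–3182)] -/
theorem pol_of_noHoles {Pol : Finset (Finset (TPt d N))} (hPol : ∀ X ∈ Pol, X.Nonempty ∧ TFaceConnected X) :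
    ∀ X ∈ Pol, X.Nonempty ∧ TFaceConnected X ∧ DMod ∅ X ∧ (X \ ∅).Nonempty := fun X hX =>
  ⟨(hPol X hX).1, (hPol X hX).2, fun a ha => by simp at ha, by rw [Finset.sdiff_empty]; exact (hPol X hX).1⟩

omit [NeZero N] in
/-- With no holes the decay length `d_M(Y, mod ∅)` is part I's `d_M(Y)` (`ThreeSorted.torusTreeLenMod_eq_of_disjoint`).
[cite: Dimock2013, App. B Theorem cluster (arXiv:1108.1335v2 TeX L3183–3194)] -/
theorem torusTreeLenMod_empty (X : Finset (TPt d N)) : torusTreeLenMod X ∅ = torusTreeLen X :=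
  torusTreeLenMod_eq_of_disjoint (Finset.disjoint_empty_right X)

/-- **PART I THEOREM `cluster`, (sunshine0), at a fixed field** — [Dimock2013] App. B, verbatim (L3178–3194): *"if H(X,Φ)
satisfies  |H(X,Φ)| ≤ H_0 e^{−κ d_M(X)}  on the support of μ with κ > 3κ_0 + 3 and H_0 ≤ c_0 then  Ξ = exp( Σ_Y H^#(Y) )
where H^#(Y) only depends on H(X) for X ⊂ Y and  |H^#(Y)| ≤ 𝒪(1) H_0 e^{−(κ − 3κ_0−3) d_M(Y)}  (sunshine0)"* — ASSEMBLED as the case `Θ = ∅` of Part 4 on the torus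
carrier: for non-empty face-connected polymers `Pol`, activities `‖a(X)‖ ≤ 2H₀e^{−κ d_M(X)}`, `max(κ₁(d), 4·2^d) ≤ κ₀`, `3κ₀ +
3 ≤ κ`, `0 ≤ H₀`, `2e·K₁(d)²·κ₀·e^{κ}·H₀ ≤ 1`: `‖H^#(Y)‖ ≤ C♯(d,κ₀)·H₀·e^{−(κ−3κ₀−3)·d_M(Y)}` for every connected union `Y`,
with the explicit `𝒪(1) = C♯(d,κ₀) = 8e·2^d·K₁(d)²·κ₀·e^{4·2^d}` (the print's `𝒪(1)` *"depends only on the dimension"* up to the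
factor `κ₀`; `c_0`-smallness is κ-dependent as the print's *"sufficiently small depending on κ"*).
[cite: Dimock2013, App. B Theorem cluster eqs. (sunshine), (sunshine0) (arXiv:1108.1335v2 TeX L3178–3194)] -/
theorem sunshine_partI {Pol : Finset (Finset (TPt d N))} (hPol : ∀ X ∈ Pol, X.Nonempty ∧ TFaceConnected X)
    {a : Finset (TPt d N) → ℂ} {κ κ₀ H₀ : ℝ} (hκ₁ : kappa₁ d ≤ κ₀) (hκv : 4 * 2 ^ d ≤ κ₀)
    (hκ : 3 * κ₀ + 3 ≤ κ) (hH₀ : 0 ≤ H₀)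
    (ha : ∀ X ∈ Pol, ‖a X‖ ≤ 2 * H₀ * Real.exp (-κ * torusTreeLen X))
    (hsmall : 2 * Real.exp 1 * K₁ d ^ 2 * κ₀ * Real.exp κ * H₀ ≤ 1)
    {Y : Finset (TPt d N)} (hY : Y ∈ cunions ∅ Pol) :
    ‖HsharpL ∅ (cunions ∅ Pol) (KY id ∅ Pol fun T => ∏ X ∈ T, a X) Y‖ ≤
      Csharp d κ₀ * H₀ * Real.exp (-(κ - 3 * κ₀ - 3) * torusTreeLen Y) := by
  have ha' : ∀ X ∈ Pol, ‖a X‖ ≤ 2 * H₀ * Real.exp (-κ * torusTreeLenMod X ∅) := fun X hX => by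
    rw [torusTreeLenMod_empty]; exact ha X hX
  have h := sunshineY ∅ (pol_of_noHoles hPol) hκ₁ hκv hκ hH₀ ha' hsmall hY
  rwa [torusTreeLenMod_empty] at h

/-- **PART I THEOREM `cluster`, (sunshine), at a fixed field**: `exp(Σ_{X∈Pol} H(X)) = exp(Σ_Y H^#(Y))` for `‖H(X)‖ ≤
H₀e^{−κ d_M(X)}` on non-empty face-connected polymers (`0 ≤ H₀ ≤ log 2` and the regime of `sunshine_partI`) — the case `Θ
= ∅` of `gog2Y`. [cite: Dimock2013, App. B Theorem cluster, display Ξ = exp(Σ_Y H^#(Y)) after L3186 (unlabelled) (arXiv:1108.1335v2 TeX L3178–3194)] -/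
theorem cluster_partI {Pol : Finset (Finset (TPt d N))} (hPol : ∀ X ∈ Pol, X.Nonempty ∧ TFaceConnected X)
    {H : Finset (TPt d N) → ℂ} {κ κ₀ H₀ : ℝ} (hκ₁ : kappa₁ d ≤ κ₀) (hκv : 4 * 2 ^ d ≤ κ₀)
    (hκ : 3 * κ₀ + 3 ≤ κ) (hH₀ : 0 ≤ H₀) (hlog : H₀ ≤ Real.log 2)
    (hH : ∀ X ∈ Pol, ‖H X‖ ≤ H₀ * Real.exp (-κ * torusTreeLen X))
    (hsmall : 2 * Real.exp 1 * K₁ d ^ 2 * κ₀ * Real.exp κ * H₀ ≤ 1) :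
    Complex.exp (∑ X ∈ Pol, H X) =
      Complex.exp (∑ Y ∈ (cunions ∅ Pol).powerset.image (fun 𝒞 => 𝒞.biUnion id),
        HsharpL ∅ (cunions ∅ Pol) (KY id ∅ Pol fun T => ∏ X ∈ T, (Complex.exp (H X) - 1)) Y) := by
  have hH' : ∀ X ∈ Pol, ‖H X‖ ≤ H₀ * Real.exp (-κ * torusTreeLenMod X ∅) := fun X hX => by
    rw [torusTreeLenMod_empty]; exact hH X hX
  exact gog2Y ∅ (pol_of_noHoles hPol) hκ₁ hκv hκ hH₀ hlog hH' hsmall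

variable {E : Type*} [MeasurableSpace E] (ν : TPt d N → MeasureTheory.Measure E)
  [∀ c, MeasureTheory.IsProbabilityMeasure (ν c)]

/-- **PART I THEOREM `cluster` WITH ITS INTEGRATION STEP** — [Dimock2013] App. B, verbatim (L3167–3175, L3178–3186): *"Consider
fields Φ and M-polymers X on a d-dimensional unit toroidal lattice. We are given localized functionals H(X,Φ) depending on Φ
only in X and integrals of the form  Ξ = ∫ exp( Σ_X H(X,Φ) ) dμ(Φ)  where dμ(Φ) = Π_x dμ(Φ(x)) is an ultralocal probability
measure. … then  Ξ = exp( Σ_Y H^#(Y) )"* — the case `Θ = ∅`, `Λ = univ` of `gog2Y_integrated`: every field integrated,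
`H(X, ·)` depending on the field only in `X`.
[cite: Dimock2013, App. B Theorem cluster, display Ξ = exp(Σ_Y H^#(Y)) after L3186 (unlabelled) (arXiv:1108.1335v2 TeX L3167–3194)] -/
theorem cluster_partI_integrated {Pol : Finset (Finset (TPt d N))} (hPol : ∀ X ∈ Pol, X.Nonempty ∧ TFaceConnected X)
    {H : Finset (TPt d N) → (TPt d N → E) → ℝ} {κ κ₀ H₀ : ℝ} (hκ₁ : kappa₁ d ≤ κ₀) (hκv : 4 * 2 ^ d ≤ κ₀)
    (hκ : 3 * κ₀ + 3 ≤ κ) (hH₀ : 0 ≤ H₀) (hlog : H₀ ≤ Real.log 2) (hHm : ∀ X ∈ Pol, Measurable (H X))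
    (hHd : ∀ X ∈ Pol, DependsOn (H X) ((X : Finset (TPt d N)) : Set (TPt d N)))
    (hH : ∀ X ∈ Pol, ∀ Φ, |H X Φ| ≤ H₀ * Real.exp (-κ * torusTreeLen X))
    (hsmall : 2 * Real.exp 1 * K₁ d ^ 2 * κ₀ * Real.exp κ * H₀ ≤ 1) :
    ((∫ Φ, Real.exp (∑ X ∈ Pol, H X Φ) ∂(MeasureTheory.Measure.pi ν) : ℝ) : ℂ) =
      Complex.exp (∑ Y ∈ (cunions ∅ Pol).powerset.image (fun 𝒞 => 𝒞.biUnion id),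
        HsharpL ∅ (cunions ∅ Pol) (fun Y => ((KYsharp ν ∅ Pol H Y : ℝ) : ℂ)) Y) := by
  have hH' : ∀ X ∈ Pol, ∀ Φ, |H X Φ| ≤ H₀ * Real.exp (-κ * torusTreeLenMod X ∅) := fun X hX Φ => by
    rw [torusTreeLenMod_empty]; exact hH X hX Φ
  have hHd' : ∀ X ∈ Pol, DependsOn (H X) ((X ∩ Finset.univ : Finset (TPt d N)) : Set (TPt d N)) := fun X hX => by
    rw [Finset.inter_univ]; exact hHd X hX
  exact gog2Y_integrated ν ∅ Finset.univ (Finset.disjoint_empty_right _) (pol_of_noHoles hPol) hκ₁ hκv hκ hH₀ hlog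
    hHm hHd' hH' hsmall

/-- **PART I (sunshine0) WITH ITS INTEGRATION STEP**: in the setting of `cluster_partI_integrated`, `‖H^#(Y)‖ ≤ C♯(d,κ₀)·H₀·
e^{−(κ − 3κ₀ − 3)·d_M(Y)}` for every connected union `Y`. [cite: Dimock2013, App. B Theorem cluster eq. (sunshine0) (arXiv:1108.1335v2 TeX L3183–3194)] -/
theorem sunshine_partI_integrated {Pol : Finset (Finset (TPt d N))} (hPol : ∀ X ∈ Pol, X.Nonempty ∧ TFaceConnected X)
    {H : Finset (TPt d N) → (TPt d N → E) → ℝ} {κ κ₀ H₀ : ℝ} (hκ₁ : kappa₁ d ≤ κ₀) (hκv : 4 * 2 ^ d ≤ κ₀)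
    (hκ : 3 * κ₀ + 3 ≤ κ) (hH₀ : 0 ≤ H₀) (hlog : H₀ ≤ Real.log 2)
    (hH : ∀ X ∈ Pol, ∀ Φ, |H X Φ| ≤ H₀ * Real.exp (-κ * torusTreeLen X))
    (hsmall : 2 * Real.exp 1 * K₁ d ^ 2 * κ₀ * Real.exp κ * H₀ ≤ 1)
    {Y : Finset (TPt d N)} (hY : Y ∈ cunions ∅ Pol) :
    ‖HsharpL ∅ (cunions ∅ Pol) (fun Y => ((KYsharp ν ∅ Pol H Y : ℝ) : ℂ)) Y‖ ≤
      Csharp d κ₀ * H₀ * Real.exp (-(κ - 3 * κ₀ - 3) * torusTreeLen Y) := by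
  have hH' : ∀ X ∈ Pol, ∀ Φ, |H X Φ| ≤ H₀ * Real.exp (-κ * torusTreeLenMod X ∅) := fun X hX Φ => by
    rw [torusTreeLenMod_empty]; exact hH X hX Φ
  have h := sunshineY_integrated ν ∅ (pol_of_noHoles hPol) hκ₁ hκv hκ hH₀ hlog hH' hsmall hY
  rwa [torusTreeLenMod_empty] at h

end PartI

/-! ## Part 7 (v1.1). Restriction to the polymers inside `Λ`: the «leading terms» identification of §3.14
(L5584–5604: *"E_k^#(Y, φ) … is identical with the function constructed in the global small field analysis in part I
… even though here we are only summing over polymers in Λ_{k+1}. This is so since by the local influence property and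
the fact that the (δE_k^+)^{loc}(Y) are the same"*) -/

section Restrict

variable {P C : Type*} [DecidableEq P] [DecidableEq C] {idx : P → Finset C} {Θ : Finset C} {Pol Pol' : Finset P}

omit [DecidableEq P] in
/-- the Ω-connected covers of a `Y ⊆ Λ` only involve polymers inside `Λ`: restricting `Pol` to a sub-family `Pol′`
containing every polymer inside `Λ` does not change them. [cite: Dimock2013BalabanII, §3.14 Lemma "leading terms", proof (arXiv:1212.5562v2 TeX L5597–5604)] -/
theorem coversY_restrict {Λ Y : Finset C} (hsub : Pol' ⊆ Pol) (hΛ : ∀ X ∈ Pol, idx X ⊆ Λ → X ∈ Pol')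
    (hY : Y ⊆ Λ) : coversY idx Θ Pol' Y = coversY idx Θ Pol Y := by
  ext T
  rw [mem_coversY, mem_coversY]
  constructor
  · rintro ⟨hT, hconn, hU⟩
    exact ⟨hT.trans hsub, hconn, hU⟩
  · rintro ⟨hT, hconn, hU⟩
    refine ⟨fun X hX => hΛ X (hT hX) ?_, hconn, hU⟩
    have h1 : idx X ⊆ UY idx T := Finset.subset_biUnion_of_mem idx hX
    rw [hU] at h1
    exact h1.trans hY

omit [DecidableEq P] in
/-- `K(Y)` for `Y ⊆ Λ` is the same whether computed from all polymers or from the polymers inside `Λ`.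
[cite: Dimock2013BalabanII, §3.14 Lemma "leading terms", proof (arXiv:1212.5562v2 TeX L5597–5604)] -/
theorem KY_restrict {R : Type*} [AddCommMonoid R] (g : Finset P → R) {Λ Y : Finset C} (hsub : Pol' ⊆ Pol)
    (hΛ : ∀ X ∈ Pol, idx X ⊆ Λ → X ∈ Pol') (hY : Y ⊆ Λ) : KY idx Θ Pol' g Y = KY idx Θ Pol g Y := by
  unfold KY
  rw [coversY_restrict hsub hΛ hY]

omit [DecidableEq P] in
/-- the unions `Y ⊆ Λ` of the regrouped gas are the same for `Pol` and for the polymers inside `Λ`.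
[cite: Dimock2013BalabanII, §3.14 Lemma "leading terms", proof (arXiv:1212.5562v2 TeX L5597–5604)] -/
theorem mem_unionsY_restrict_iff {Λ Y : Finset C} (hsub : Pol' ⊆ Pol) (hΛ : ∀ X ∈ Pol, idx X ⊆ Λ → X ∈ Pol')
    (hY : Y ⊆ Λ) : Y ∈ unionsY idx Θ Pol' ↔ Y ∈ unionsY idx Θ Pol := by
  unfold unionsY
  simp only [Finset.mem_filter, Finset.mem_image, Finset.mem_powerset]
  constructor
  · rintro ⟨⟨T, hT, hU⟩, hne⟩
    exact ⟨⟨T, hT.trans hsub, hU⟩, hne⟩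
  · rintro ⟨⟨T, hT, hU⟩, hne⟩
    refine ⟨⟨T, fun X hX => hΛ X (hT hX) ?_, hU⟩, hne⟩
    have h1 : idx X ⊆ UY idx T := Finset.subset_biUnion_of_mem idx hX
    rw [hU] at h1
    exact h1.trans hY

omit [DecidableEq P] in
/-- **THE LOCAL INFLUENCE PROPERTY, VOLUME FORM**: `H^#(Y)` is the same for two finite volumes of unions that agree on the
`Y′ ⊆ Y` and two activity families that agree there. [cite: Dimock2013BalabanII, App. F Theorem cluster3, remark (arXiv:1212.5562v2 TeX L7000)] -/
theorem HsharpL_congr_volume {L L' : Finset (Finset C)} {w w' : Finset C → ℂ} {Y : Finset C}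
    (hL : ∀ Y' ⊆ Y, (Y' ∈ L' ↔ Y' ∈ L)) (hw : ∀ Y' ∈ L, Y' ⊆ Y → w' Y' = w Y') :
    HsharpL Θ L' w' Y = HsharpL Θ L w Y := by
  unfold HsharpL
  have hsub : ∀ {𝒞 : Finset (Finset C)}, 𝒞.biUnion id = Y → ∀ Y' ∈ 𝒞, Y' ⊆ Y := by
    intro 𝒞 hU Y' hY'
    rw [← hU]
    exact Finset.subset_biUnion_of_mem id hY'
  have hidx : (L'.powerset.filter fun 𝒞 => 𝒞.biUnion id = Y) = L.powerset.filter fun 𝒞 => 𝒞.biUnion id = Y := by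
    ext 𝒞
    simp only [Finset.mem_filter, Finset.mem_powerset]
    constructor
    · rintro ⟨h𝒞, hU⟩
      exact ⟨fun Y' hY' => (hL Y' (hsub hU Y' hY')).1 (h𝒞 hY'), hU⟩
    · rintro ⟨h𝒞, hU⟩
      exact ⟨fun Y' hY' => (hL Y' (hsub hU Y' hY')).2 (h𝒞 hY'), hU⟩
  rw [hidx]
  refine Finset.sum_congr rfl fun 𝒞 h𝒞 => ?_
  obtain ⟨h𝒞L, hU⟩ := Finset.mem_filter.1 h𝒞
  rw [Finset.mem_powerset] at h𝒞L
  exact truncatedWeight_congr fun Y' hY' => hw Y' (h𝒞L hY') (hsub hU Y' hY')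

end Restrict

section RestrictTorus

variable {d N : ℕ} {Θ Λ : Finset (TPt d N)} {Pol Pol' : Finset (Finset (TPt d N))}

/-- the Ω-connected unions `Y ⊆ Λ` are the same for `Pol` and for a sub-family `Pol′` containing every polymer inside `Λ`.
[cite: Dimock2013BalabanII, §3.14 Lemma "leading terms", proof (arXiv:1212.5562v2 TeX L5597–5604)] -/
theorem mem_cunions_restrict_iff (hsub : Pol' ⊆ Pol) (hΛ : ∀ X ∈ Pol, X ⊆ Λ → X ∈ Pol') {Y : Finset (TPt d N)}
    (hY : Y ⊆ Λ) : Y ∈ cunions Θ Pol' ↔ Y ∈ cunions Θ Pol := by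
  rw [mem_cunions, mem_cunions, mem_unionsY_restrict_iff (idx := id) (Θ := Θ) hsub hΛ hY,
    coversY_restrict (idx := id) (Θ := Θ) hsub hΛ hY]

/-- **THE «LEADING TERMS» IDENTIFICATION** — [Dimock2013BalabanII] §3.14, verbatim (L5597–5604): *"The function E_k^#(Y, φ)
defined here is the same as the global definition in part I, even though here we are only summing over polymers in
Λ_{k+1}. This is so since by the local influence property and the fact that the (δE_k^+)^{loc}(Y) are the same."* —
PROVED for the kernel's `H^#`: for `Y ⊆ Λ` and any sub-family `Pol′ ⊆ Pol` containing every polymer inside `Λ` (e.g.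
`Pol ∩ {X ⊆ Λ}`), the `H^#(Y)` of the cluster expansion of `Pol′` (volume `cunions Θ Pol′`, activities `K` computed from
`Pol′`) equals the `H^#(Y)` of the cluster expansion of all of `Pol`.
[cite: Dimock2013BalabanII, §3.14 Lemma "leading terms" (arXiv:1212.5562v2 TeX L5584–5604)] -/
theorem HsharpL_restrict (hsub : Pol' ⊆ Pol) (hΛ : ∀ X ∈ Pol, X ⊆ Λ → X ∈ Pol')
    (g : Finset (Finset (TPt d N)) → ℂ) {Y : Finset (TPt d N)} (hY : Y ⊆ Λ) :
    HsharpL Θ (cunions Θ Pol') (KY id Θ Pol' g) Y = HsharpL Θ (cunions Θ Pol) (KY id Θ Pol g) Y :=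
  HsharpL_congr_volume (fun _ hY' => mem_cunions_restrict_iff hsub hΛ (hY'.trans hY))
    fun _ _ hY' => KY_restrict (idx := id) g hsub hΛ (hY'.trans hY)

/-- The same for the restriction `Pol ∩ {X ⊆ Λ}` itself (*"here we are only summing over polymers in Λ_{k+1}"*).
[cite: Dimock2013BalabanII, §3.14 Lemma "leading terms" (arXiv:1212.5562v2 TeX L5584–5604)] -/
theorem HsharpL_restrict_filter (Θ Λ : Finset (TPt d N)) (Pol : Finset (Finset (TPt d N)))
    (g : Finset (Finset (TPt d N)) → ℂ) {Y : Finset (TPt d N)} (hY : Y ⊆ Λ) :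
    HsharpL Θ (cunions Θ (Pol.filter fun X => X ⊆ Λ)) (KY id Θ (Pol.filter fun X => X ⊆ Λ) g) Y =
      HsharpL Θ (cunions Θ Pol) (KY id Θ Pol g) Y :=
  HsharpL_restrict (Finset.filter_subset _ _) (fun _ hX hXΛ => Finset.mem_filter.2 ⟨hX, hXΛ⟩) g hY

variable [NeZero N] {E : Type*} [MeasurableSpace E] (ν : TPt d N → MeasureTheory.Measure E)

/-- the integrated activities `K^#(Y)`, `Y ⊆ Λ′`, are the same for `Pol` and for a sub-family `Pol′` containing every
polymer inside `Λ′`. [cite: Dimock2013BalabanII, §3.14 Lemma "leading terms", proof (arXiv:1212.5562v2 TeX L5597–5604)] -/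
theorem KYsharp_restrict {Λ' : Finset (TPt d N)} (hsub : Pol' ⊆ Pol) (hΛ : ∀ X ∈ Pol, X ⊆ Λ' → X ∈ Pol')
    (H : Finset (TPt d N) → (TPt d N → E) → ℝ) {Y : Finset (TPt d N)} (hY : Y ⊆ Λ') :
    KYsharp ν Θ Pol' H Y = KYsharp ν Θ Pol H Y := by
  unfold KYsharp KYfield
  simp_rw [KY_restrict (idx := id) (Θ := Θ) _ hsub hΛ hY]

/-- **THE «LEADING TERMS» IDENTIFICATION, INTEGRATED FORM**: for `Y ⊆ Λ′`, the `H^#(Y)` of the INTEGRATED activities `K^#`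
computed from `Pol′` equals the one computed from all of `Pol` (*"Before the evaluation in φ this is just the quantity
considered in part I, except that the sum over Y is restricted to Λ_{k+1}"*, L5581–5583).
[cite: Dimock2013BalabanII, §3.14 Lemma "leading terms" (arXiv:1212.5562v2 TeX L5578–5604)] -/
theorem HsharpL_KYsharp_restrict {Λ' : Finset (TPt d N)} (hsub : Pol' ⊆ Pol) (hΛ : ∀ X ∈ Pol, X ⊆ Λ' → X ∈ Pol')
    (H : Finset (TPt d N) → (TPt d N → E) → ℝ) {Y : Finset (TPt d N)} (hY : Y ⊆ Λ') :
    HsharpL Θ (cunions Θ Pol') (fun Y' => ((KYsharp ν Θ Pol' H Y' : ℝ) : ℂ)) Y =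
      HsharpL Θ (cunions Θ Pol) (fun Y' => ((KYsharp ν Θ Pol H Y' : ℝ) : ℂ)) Y :=
  HsharpL_congr_volume (fun _ hY' => mem_cunions_restrict_iff hsub hΛ (hY'.trans hY))
    fun _ _ hY' => by rw [KYsharp_restrict ν hsub hΛ H (hY'.trans hY)]

end RestrictTorus

/-! ## Non-vacuity -/

/-- The polymer hypothesis of Part 6 is inhabited on every torus: a single unit cube. [folklore] -/
example {d N : ℕ} (a : TPt d N) :
    ∀ X ∈ ({{a}} : Finset (Finset (TPt d N))), X.Nonempty ∧ TFaceConnected X := by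
  intro X hX
  rw [Finset.mem_singleton] at hX
  subst hX
  refine ⟨Finset.singleton_nonempty a, fun x hx y hy => ?_⟩
  rw [Finset.mem_singleton] at hx hy
  subst hx; subst hy
  exact Relation.ReflTransGen.refl

/-- The constants regime of Parts 4–6 is inhabited in every dimension (the sibling's `regime_nonempty`). [folklore] -/
example (d : ℕ) : ∃ κ₀ κ H₀ : ℝ, kappa₁ d ≤ κ₀ ∧ 4 * 2 ^ d ≤ κ₀ ∧ 3 * κ₀ + 3 ≤ κ ∧ 0 < H₀ ∧ H₀ ≤ Real.log 2 ∧
    2 * Real.exp 1 * K₁ d ^ 2 * κ₀ * Real.exp κ * H₀ ≤ 1 :=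
  regime_nonempty d

end Literature.MathematicalPhysics.QuantumFieldTheory.Dimock2011to13.ClusterExpansionByUnions

end
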